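import Summits.KontsevichZagierPeriods.KontsevichZagierPeriods.Theses.HyperbolicBloch
import Literature.NumberTheory.Transcendental.KZSemiCanonicalReductionProofs
import Literature.NumberTheory.Transcendental.KZCalculusProofs
import Literature.MeasureTheory.Lebesgue.PolynomialZeroSet
import Literature.NumberTheory.Transcendental.KZIdealTetrahedron
import Literature.NumberTheory.Transcendental.KZSubcalculusInvariants

/-!
# Disproof work file for the crux `HyperbolicBloch.PachnerTwoThree` (stmt-KontsevichZagierPeriods-3470)

Standing adversary (refuter, cdisprove mode), generations g2–g3 — everything below is sorry-free.
VERDICT: the crux is TRUE (`pachnerTwoThree_holds`, §4); its three interior hypotheses are each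
load-bearing at the KZ level (§5c); the `IsAlgebraic` hypotheses and the shape `t⁻³` of the
integrand are NOT used (§4 `pachnerTwoThree_general`); the natural strengthening "the two unions
are equal as sets" is FALSE (§5 `not_exactUnion`).  Findings, indexed:

* §1 `Identities` — ring identities of the 2–3 move for the crux's verbatim `L`, `S`: spokes
  `A·L u q = β·L u v − γ·L w u`, radical planes `A·S u v q = γ·S u v w − S u v w(q̂)·L u v`,
  barycentric power `A·S u v w(q̂) = −Σ|edge|²·(weights)`; `(α,β,γ) = (L v w q̂, L w u q̂, L u v q̂)`.
* §2 `core`, `two_three_pointwise` — the POINTWISE 2–3 indicator identity off the null scaffold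
  `{S u v w = 0} ∪ {L u q = 0} ∪ {L v q = 0} ∪ {L w q = 0}` (pure real inequalities).
* §3 `volume_scaffold_eq_zero` — the scaffold is Lebesgue-null (`MvPolynomial.volume_zeroSet_eq_zero`).
* §4 `pachnerTwoThree_general` (ANY common integrand, no algebraicity), `pachnerTwoThree_holds` —
  THE CRUX: glue `rP`,`rI` (one `domainAddRel`) + `KZ.of_sub_sum_of_mem_relations` over `r₁,r₂,r₃`.
* §4b `core_convex`, `pachnerTwoThree_convex_general` — the CORRECT relation when `q` crosses the
  edge `uv` inside the circumcircle: `[P uvw] + [inner] + [P uqv] − [P vwq] − [P wuq] ∈ relations`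
  (repair line for degenerate bipyramids: the re-oriented prism changes side).
* §5 `aeIdentity_holds`; `not_exactUnion` (refuted strengthening, rational witness on the big
  hemisphere); `not_aeIdentityWithoutInterior₁` (box witness at `C₂ = (−5,5,5i,−2i)`).
* §5b `prismRep` — NON-VACUITY: every typed prism over a ccw triangle with algebraic vertices is a
  `KZ.IntegralRep 3` with integrand `t⁻³`, value `= idealTetrahedronVolume((c−a)/(b−a)) > 0`
  (similarity transport of the tree's `idealTetrahedron`; also serves `IdealTetraRepExists`).
* §5c `C₂_not_mem`, `pachnerTwoThree_false_without_interior₁/₂/₃` — KZ-LEVEL load-bearing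
  analysis: the crux with any one interior hypothesis deleted is FALSE (five honest reps at `C₂`;
  the typed combination differs from the correct relation by a prism of positive volume).
* §6 `idealTetraRepExists_holds` — by-product: the support item `IdealTetraRepExists` (stmt-3473)
  holds (`prismRep`, `innerRep`).
* §7 (g3) `pachnerTwoThreeClosed_holds` — TIGHTNESS ON THE INSIDE: the three strict interior
  hypotheses can be weakened simultaneously to `0 ≤ …` (closed triangle, non-degeneracy
  `0 < L u v ŵ` explicit); `core_edge`/`two_three_pointwise_edge` (on an open edge the typed
  `prism(u,v,q)` is EMPTY and the move is the 2–2 move, scaffold `{S u v w = 0} ∪ {L w q = 0}`),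
  `pachnerTwoThree_edge_general`, `eq_vertex`, `pachnerTwoThree_vertex_general`,
  `concl_of_cyclic` (cyclic relabelling of the conclusion shape `Concl`),
  `pachnerTwoThree_closed_general` (any common integrand).  With §5c (`q̂` strictly across an
  edge refutes the typed combination) the weakening `0 < ↦ 0 ≤` is as far as the interior
  hypotheses can be relaxed: the boundary of validity passes exactly through the edges.
* §8 (g3) audit of the ACTIVE line's hardest stub `stub_indicatorCriterion` (skeleton fcf5d5fe):
  VERDICT TRUE, no kill — proof route by atoms of the Boolean algebra with the tree's
  `IntegralRep.restrict` / `KZ.of_sub_sum_of_mem_relations` / `KZ.of_sub_of_mem_relations_of_eqOn`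
  / `KZ.of_mem_relations_of_volume_eq_zero` (docstring of §8); `indicatorCriterion_single` (model),
  `indicatorCriterion_false_without_commonIntegrand` (load-bearing hypothesis),
  `indicatorCriterion_converse_add` (SHARPNESS: an equivalence inside the additivity sub-calculus,
  via `KZ.restrictedEval`).

Nothing here is a near-miss: no `sorry`.  Dead ends for a disprover: exact-rational / symbolic
counterexample search is pointless (identity proved); dropping `IsAlgebraic` or changing the
integrand cannot produce a counterexample (general theorem); only the interior hypotheses matter,
and relaxing them to the CLOSED triangle keeps the statement true (§7, PROVED in g3: the degenerate
pieces are empty or coincide) — the first false configurations are `q` strictly across an edge (§5c).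
The fully degenerate triangle (`L u v ŵ = 0`, all of `u v w q` on a line) is not covered by §7: there
all typed prisms are empty (edge forms sum to the vanishing area) and the statement is believed
trivially/vacuously true — unverified, and outside every intended use.
-/

noncomputable section

open Set MeasureTheory MvPolynomial
open Literature.NumberTheory.Transcendental Literature.ModelTheory.ExponentialFields

namespace Summit.KontsevichZagierPeriods.Cruxes.PachnerTwoThree.Disproof

/-! ## §1 Identities -/
section Identities

variable {L : ℂ → ℂ → (Fin 3 → ℝ) → ℝ} {S : ℂ → ℂ → ℂ → (Fin 3 → ℝ) → ℝ}

/-- The boundary point `q̂ = (Re q, Im q, 0)`. -/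
abbrev hat (q : ℂ) : Fin 3 → ℝ := ![q.re, q.im, 0]

@[simp] lemma hat_zero (q : ℂ) : hat q 0 = q.re := rfl
@[simp] lemma hat_one (q : ℂ) : hat q 1 = q.im := rfl
@[simp] lemma hat_two (q : ℂ) : hat q 2 = 0 := rfl

variable (hL : ∀ u v p, L u v p = (v.re - u.re) * (p 1 - u.im) - (v.im - u.im) * (p 0 - u.re))
  (hS : ∀ u v w p, S u v w p = (p 0 ^ 2 + p 1 ^ 2 + p 2 ^ 2) * (u.re * (v.im - w.im) - u.im * (v.re - w.re) + (v.re * w.im - v.im * w.re)) - p 0 * (Complex.normSq u * (v.im - w.im) - u.im * (Complex.normSq v - Complex.normSq w) + (Complex.normSq v * w.im - v.im * Complex.normSq w)) + p 1 * (Complex.normSq u * (v.re - w.re) - u.re * (Complex.normSq v - Complex.normSq w) + (Complex.normSq v * w.re - v.re * Complex.normSq w)) - (Complex.normSq u * (v.re * w.im - v.im * w.re) - u.re * (Complex.normSq v * w.im - v.im * Complex.normSq w) + u.im * (Complex.normSq v * w.re - v.re * Complex.normSq w)))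
include hL

/-- Partition of unity: the three edge forms sum to the (constant) double area. -/
theorem L_sum (u v w : ℂ) (p : Fin 3 → ℝ) :
    L u v p + L v w p + L w u p = L u v (hat w) + L v w (hat w) + L w u (hat w) := by
  simp only [hL, hat_zero, hat_one]; ring

theorem L_self (u : ℂ) (p : Fin 3 → ℝ) : L u u p = 0 := by simp only [hL]; ring

theorem L_anti (u v : ℂ) (p : Fin 3 → ℝ) : L v u p = -L u v p := by simp only [hL]; ring

/-- Spoke identities: `A · L u q = β · L u v − γ · L w u` etc., `A = α + β + γ` the double area,
`(α, β, γ) = (L v w q̂, L w u q̂, L u v q̂)` the barycentric coordinates of `q̂`. -/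
theorem spoke_uq (u v w q : ℂ) (p : Fin 3 → ℝ) :
    (L u v (hat q) + L v w (hat q) + L w u (hat q)) * L u q p
      = L w u (hat q) * L u v p - L u v (hat q) * L w u p := by
  simp only [hL, hat_zero, hat_one]; ring

theorem spoke_qu (u v w q : ℂ) (p : Fin 3 → ℝ) :
    (L u v (hat q) + L v w (hat q) + L w u (hat q)) * L q u p
      = L u v (hat q) * L w u p - L w u (hat q) * L u v p := by
  simp only [hL, hat_zero, hat_one]; ring

theorem spoke_vq (u v w q : ℂ) (p : Fin 3 → ℝ) :
    (L u v (hat q) + L v w (hat q) + L w u (hat q)) * L v q p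
      = L u v (hat q) * L v w p - L v w (hat q) * L u v p := by
  simp only [hL, hat_zero, hat_one]; ring

theorem spoke_qv (u v w q : ℂ) (p : Fin 3 → ℝ) :
    (L u v (hat q) + L v w (hat q) + L w u (hat q)) * L q v p
      = L v w (hat q) * L u v p - L u v (hat q) * L v w p := by
  simp only [hL, hat_zero, hat_one]; ring

theorem spoke_wq (u v w q : ℂ) (p : Fin 3 → ℝ) :
    (L u v (hat q) + L v w (hat q) + L w u (hat q)) * L w q p
      = L v w (hat q) * L w u p - L w u (hat q) * L v w p := by
  simp only [hL, hat_zero, hat_one]; ring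

theorem spoke_qw (u v w q : ℂ) (p : Fin 3 → ℝ) :
    (L u v (hat q) + L v w (hat q) + L w u (hat q)) * L q w p
      = L w u (hat q) * L v w p - L v w (hat q) * L w u p := by
  simp only [hL, hat_zero, hat_one]; ring

/-- The spoke through `u` evaluated at the far vertex `w` is the barycentric weight `β`. -/
theorem L_uq_hat_w (u w q : ℂ) : L u q (hat w) = L w u (hat q) := by
  simp only [hL, hat_zero, hat_one]; ring

theorem L_vq_hat_u (u v q : ℂ) : L v q (hat u) = L u v (hat q) := by
  simp only [hL, hat_zero, hat_one]; ring

theorem L_wq_hat_v (v w q : ℂ) : L w q (hat v) = L v w (hat q) := by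
  simp only [hL, hat_zero, hat_one]; ring

include hS

/-- Radical-plane identities: `A · S u v q = γ · S u v w + K · L u v` with `K = −S u v w q̂`. -/
theorem sphere_uvq (u v w q : ℂ) (p : Fin 3 → ℝ) :
    (L u v (hat q) + L v w (hat q) + L w u (hat q)) * S u v q p
      = L u v (hat q) * S u v w p + (-S u v w (hat q)) * L u v p := by
  simp only [hL, hS, hat_zero, hat_one, hat_two, Complex.normSq_apply]; ring

theorem sphere_vwq (u v w q : ℂ) (p : Fin 3 → ℝ) :
    (L u v (hat q) + L v w (hat q) + L w u (hat q)) * S v w q p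
      = L v w (hat q) * S u v w p + (-S u v w (hat q)) * L v w p := by
  simp only [hL, hS, hat_zero, hat_one, hat_two, Complex.normSq_apply]; ring

theorem sphere_wuq (u v w q : ℂ) (p : Fin 3 → ℝ) :
    (L u v (hat q) + L v w (hat q) + L w u (hat q)) * S w u q p
      = L w u (hat q) * S u v w p + (-S u v w (hat q)) * L w u p := by
  simp only [hL, hS, hat_zero, hat_one, hat_two, Complex.normSq_apply]; ring

/-- Barycentric power identity: `A · S u v w q̂ = −(|v−w|² βγ + |w−u|² γα + |u−v|² αβ)`. -/
theorem power_hat (u v w q : ℂ) :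
    (L u v (hat q) + L v w (hat q) + L w u (hat q)) * S u v w (hat q)
      = -(((v.re - w.re) ^ 2 + (v.im - w.im) ^ 2) * L w u (hat q) * L u v (hat q)
        + ((w.re - u.re) ^ 2 + (w.im - u.im) ^ 2) * L u v (hat q) * L v w (hat q)
        + ((u.re - v.re) ^ 2 + (u.im - v.im) ^ 2) * L v w (hat q) * L w u (hat q)) := by
  simp only [hL, hS, hat_zero, hat_one, hat_two, Complex.normSq_apply]; ring

omit hL in
/-- `S` is alternating: swapping two vertices flips the sign. -/
theorem S_swap12 (u v w : ℂ) (p : Fin 3 → ℝ) : S v u w p = -S u v w p := by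
  simp only [hS]; ring

omit hL in
theorem S_cyclic (u v w : ℂ) (p : Fin 3 → ℝ) : S v w u p = S u v w p := by
  simp only [hS]; ring

end Identities

/-! ## §2 The pointwise 2–3 identity -/
section Pointwise

/-- **Abstract core of the 2–3 move** (pure real inequalities).  `α β γ > 0` are the barycentric
weights of the inner point, `K > 0` minus its power, `a b c` the edge forms of the moving point,
`σ` its big-sphere value; the nine remaining reals are the spoke and small-sphere values, tied to
the former by the §1 identities (hypotheses `e…`).  Off `σ = 0` and the three spokes the two sides
of the 2–3 move contain the same points. -/
theorem core {α β γ K A a b c σ Luq Lqu Lvq Lqv Lwq Lqw Suvq Svwq Swuq : ℝ}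
    (hα : 0 < α) (hβ : 0 < β) (hγ : 0 < γ) (hK : 0 < K) (hA : 0 < A)
    (euq : A * Luq = β * c - γ * b) (equ : A * Lqu = γ * b - β * c)
    (evq : A * Lvq = γ * a - α * c) (eqv : A * Lqv = α * c - γ * a)
    (ewq : A * Lwq = α * b - β * a) (eqw : A * Lqw = β * a - α * b)
    (e₁ : A * Suvq = γ * σ + K * c) (e₂ : A * Svwq = α * σ + K * a)
    (e₃ : A * Swuq = β * σ + K * b)
    (hσ : σ ≠ 0) (hu : Luq ≠ 0) (hv : Lvq ≠ 0) (hw : Lwq ≠ 0) :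
    ((0 < c ∧ 0 < a ∧ 0 < b ∧ 0 < σ) ∨ (σ < 0 ∧ 0 < Suvq ∧ 0 < Svwq ∧ 0 < Swuq)) ↔
    ((0 < c ∧ 0 < Lvq ∧ 0 < Lqu ∧ 0 < Suvq) ∨ (0 < a ∧ 0 < Lwq ∧ 0 < Lqv ∧ 0 < Svwq) ∨
      (0 < b ∧ 0 < Luq ∧ 0 < Lqw ∧ 0 < Swuq)) := by
  have t : ∀ {X Y : ℝ}, A * X = Y → (0 < X ↔ 0 < Y) := fun e => by
    rw [← e, mul_pos_iff_of_pos_left hA]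
  have h₁ : β * c - γ * b ≠ 0 := by rw [← euq]; exact mul_ne_zero hA.ne' hu
  have h₂ : γ * a - α * c ≠ 0 := by rw [← evq]; exact mul_ne_zero hA.ne' hv
  have h₃ : α * b - β * a ≠ 0 := by rw [← ewq]; exact mul_ne_zero hA.ne' hw
  rw [t euq, t equ, t evq, t eqv, t ewq, t eqw, t e₁, t e₂, t e₃]
  have lin : α * (β * c - γ * b) + β * (γ * a - α * c) + γ * (α * b - β * a) = 0 := by ring
  constructor
  · intro h
    have key : 0 < a ∧ 0 < b ∧ 0 < c ∧ 0 < γ * σ + K * c ∧ 0 < α * σ + K * a ∧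
        0 < β * σ + K * b := by
      rcases h with ⟨hc, ha, hb, hs⟩ | ⟨hs, k1, k2, k3⟩
      · exact ⟨ha, hb, hc, by positivity, by positivity, by positivity⟩
      · have hγσ : γ * σ < 0 := mul_neg_of_pos_of_neg hγ hs
        have hασ : α * σ < 0 := mul_neg_of_pos_of_neg hα hs
        have hβσ : β * σ < 0 := mul_neg_of_pos_of_neg hβ hs
        exact ⟨pos_of_mul_pos_right (by linarith) hK.le, pos_of_mul_pos_right (by linarith) hK.le,
          pos_of_mul_pos_right (by linarith) hK.le, k1, k2, k3⟩
    obtain ⟨ha, hb, hc, hs1, hs2, hs3⟩ := key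
    rcases lt_or_gt_of_ne h₁ with k₁ | k₁ <;> rcases lt_or_gt_of_ne h₂ with k₂ | k₂ <;>
      rcases lt_or_gt_of_ne h₃ with k₃ | k₃
    · exfalso
      have := mul_neg_of_pos_of_neg hα k₁
      have := mul_neg_of_pos_of_neg hβ k₂
      have := mul_neg_of_pos_of_neg hγ k₃
      linarith
    · exact Or.inr (Or.inl ⟨ha, k₃, by linarith, hs2⟩)
    · exact Or.inl ⟨hc, k₂, by linarith, hs1⟩
    · exact Or.inl ⟨hc, k₂, by linarith, hs1⟩
    · exact Or.inr (Or.inr ⟨hb, k₁, by linarith, hs3⟩)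
    · exact Or.inr (Or.inl ⟨ha, k₃, by linarith, hs2⟩)
    · exact Or.inr (Or.inr ⟨hb, k₁, by linarith, hs3⟩)
    · exfalso
      have := mul_pos hα k₁
      have := mul_pos hβ k₂
      have := mul_pos hγ k₃
      linarith
  · intro h
    rcases h with ⟨hc, h2, h1, hs⟩ | ⟨ha, h3, h2, hs⟩ | ⟨hb, h1, h3, hs⟩
    · have ha : 0 < a := by
        have : 0 < γ * a := by nlinarith [mul_pos hα hc]
        exact pos_of_mul_pos_right this hγ.le
      have hb : 0 < b := by
        have : 0 < γ * b := by nlinarith [mul_pos hβ hc]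
        exact pos_of_mul_pos_right this hγ.le
      rcases lt_or_gt_of_ne hσ with k | k
      · refine Or.inr ⟨k, hs, ?_, ?_⟩
        · have e : γ * (α * σ + K * a) = α * (γ * σ + K * c) + K * (γ * a - α * c) := by ring
          have : 0 < γ * (α * σ + K * a) := by rw [e]; positivity
          exact pos_of_mul_pos_right this hγ.le
        · have e : γ * (β * σ + K * b) = β * (γ * σ + K * c) + K * (γ * b - β * c) := by ring
          have : 0 < γ * (β * σ + K * b) := by rw [e]; positivity
          exact pos_of_mul_pos_right this hγ.le
      · exact Or.inl ⟨hc, ha, hb, k⟩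
    · have hb : 0 < b := by
        have : 0 < α * b := by nlinarith [mul_pos hβ ha]
        exact pos_of_mul_pos_right this hα.le
      have hc : 0 < c := by
        have : 0 < α * c := by nlinarith [mul_pos hγ ha]
        exact pos_of_mul_pos_right this hα.le
      rcases lt_or_gt_of_ne hσ with k | k
      · refine Or.inr ⟨k, ?_, hs, ?_⟩
        · have e : α * (γ * σ + K * c) = γ * (α * σ + K * a) + K * (α * c - γ * a) := by ring
          have : 0 < α * (γ * σ + K * c) := by rw [e]; positivity
          exact pos_of_mul_pos_right this hα.le
        · have e : α * (β * σ + K * b) = β * (α * σ + K * a) + K * (α * b - β * a) := by ring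
          have : 0 < α * (β * σ + K * b) := by rw [e]; positivity
          exact pos_of_mul_pos_right this hα.le
      · exact Or.inl ⟨hc, ha, hb, k⟩
    · have hc : 0 < c := by
        have : 0 < β * c := by nlinarith [mul_pos hγ hb]
        exact pos_of_mul_pos_right this hβ.le
      have ha : 0 < a := by
        have : 0 < β * a := by nlinarith [mul_pos hα hb]
        exact pos_of_mul_pos_right this hβ.le
      rcases lt_or_gt_of_ne hσ with k | k
      · refine Or.inr ⟨k, ?_, ?_, hs⟩
        · have e : β * (γ * σ + K * c) = γ * (β * σ + K * b) + K * (β * c - γ * b) := by ring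
          have : 0 < β * (γ * σ + K * c) := by rw [e]; positivity
          exact pos_of_mul_pos_right this hβ.le
        · have e : β * (α * σ + K * a) = α * (β * σ + K * b) + K * (β * a - α * b) := by ring
          have : 0 < β * (α * σ + K * a) := by rw [e]; positivity
          exact pos_of_mul_pos_right this hβ.le
      · exact Or.inl ⟨hc, ha, hb, k⟩

variable {L : ℂ → ℂ → (Fin 3 → ℝ) → ℝ} {S : ℂ → ℂ → ℂ → (Fin 3 → ℝ) → ℝ}
variable (hL : ∀ u v p, L u v p = (v.re - u.re) * (p 1 - u.im) - (v.im - u.im) * (p 0 - u.re))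
  (hS : ∀ u v w p, S u v w p = (p 0 ^ 2 + p 1 ^ 2 + p 2 ^ 2) * (u.re * (v.im - w.im) - u.im * (v.re - w.re) + (v.re * w.im - v.im * w.re)) - p 0 * (Complex.normSq u * (v.im - w.im) - u.im * (Complex.normSq v - Complex.normSq w) + (Complex.normSq v * w.im - v.im * Complex.normSq w)) + p 1 * (Complex.normSq u * (v.re - w.re) - u.re * (Complex.normSq v - Complex.normSq w) + (Complex.normSq v * w.re - v.re * Complex.normSq w)) - (Complex.normSq u * (v.re * w.im - v.im * w.re) - u.re * (Complex.normSq v * w.im - v.im * Complex.normSq w) + u.im * (Complex.normSq v * w.re - v.re * Complex.normSq w)))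
include hL

/-- If `q̂` is strictly inside the triangle then `u ≠ v` (as points of the plane). -/
theorem dist_sq_pos_of_inside {u v q : ℂ} (h1 : 0 < L u v (hat q)) :
    0 < (u.re - v.re) ^ 2 + (u.im - v.im) ^ 2 := by
  by_contra hle
  push Not at hle
  have e1 : u.re - v.re = 0 := by nlinarith [sq_nonneg (u.re - v.re), sq_nonneg (u.im - v.im)]
  have e2 : u.im - v.im = 0 := by nlinarith [sq_nonneg (u.re - v.re), sq_nonneg (u.im - v.im)]
  have : L u v (hat q) = 0 := by
    rw [hL]
    have h1' : v.re = u.re := by linarith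
    have h2' : v.im = u.im := by linarith
    rw [h1', h2']; ring
  linarith

include hS

/-- The inner point lies strictly inside the circumcircle: `S u v w q̂ < 0` (so `K = −S u v w q̂ > 0`). -/
theorem S_hat_neg {u v w q : ℂ} (h1 : 0 < L u v (hat q)) (h2 : 0 < L v w (hat q))
    (h3 : 0 < L w u (hat q)) : S u v w (hat q) < 0 := by
  have hA : 0 < L u v (hat q) + L v w (hat q) + L w u (hat q) := by linarith
  have huv := dist_sq_pos_of_inside hL h1
  have hE : 0 < ((v.re - w.re) ^ 2 + (v.im - w.im) ^ 2) * L w u (hat q) * L u v (hat q)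
        + ((w.re - u.re) ^ 2 + (w.im - u.im) ^ 2) * L u v (hat q) * L v w (hat q)
        + ((u.re - v.re) ^ 2 + (u.im - v.im) ^ 2) * L v w (hat q) * L w u (hat q) := by
    have t1 : 0 ≤ ((v.re - w.re) ^ 2 + (v.im - w.im) ^ 2) * L w u (hat q) * L u v (hat q) := by
      positivity
    have t2 : 0 ≤ ((w.re - u.re) ^ 2 + (w.im - u.im) ^ 2) * L u v (hat q) * L v w (hat q) := by
      positivity
    have t3 : 0 < ((u.re - v.re) ^ 2 + (u.im - v.im) ^ 2) * L v w (hat q) * L w u (hat q) := by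
      positivity
    linarith
  have hp := power_hat hL hS u v w q
  have : (L u v (hat q) + L v w (hat q) + L w u (hat q)) * S u v w (hat q) < 0 := by linarith
  exact lt_of_mul_lt_mul_left (b := S u v w (hat q)) (c := 0) (by simpa using this) hA.le

/-- **The pointwise 2–3 identity.**  For `q̂` strictly inside the counter-clockwise triangle
`(u, v, w)` and a point `p` off the scaffold `S u v w p · L u q p · L v q p · L w q p = 0`:
`p ∈ prism(u,v,w) ∪ inner ⇔ p ∈ prism(u,v,q) ∪ prism(v,w,q) ∪ prism(w,u,q)` (typed membership
conditions, verbatim).  Both unions are disjoint unions (`prism_inter_inner`, `prism_inter_prism`). -/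
theorem two_three_pointwise {u v w q : ℂ} (h1 : 0 < L u v (hat q)) (h2 : 0 < L v w (hat q))
    (h3 : 0 < L w u (hat q)) {p : Fin 3 → ℝ} (hσ : S u v w p ≠ 0) (hu : L u q p ≠ 0)
    (hv : L v q p ≠ 0) (hw : L w q p ≠ 0) :
    ((0 < p 2 ∧ 0 < L u v p ∧ 0 < L v w p ∧ 0 < L w u p ∧ 0 < S u v w p) ∨
      (0 < p 2 ∧ S u v w p < 0 ∧ 0 < S u v q p ∧ 0 < S v w q p ∧ 0 < S w u q p)) ↔
    ((0 < p 2 ∧ 0 < L u v p ∧ 0 < L v q p ∧ 0 < L q u p ∧ 0 < S u v q p) ∨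
      (0 < p 2 ∧ 0 < L v w p ∧ 0 < L w q p ∧ 0 < L q v p ∧ 0 < S v w q p) ∨
      (0 < p 2 ∧ 0 < L w u p ∧ 0 < L u q p ∧ 0 < L q w p ∧ 0 < S w u q p)) := by
  by_cases ht : 0 < p 2
  · simp only [ht, true_and]
    have hA : 0 < L u v (hat q) + L v w (hat q) + L w u (hat q) := by linarith
    have hK : 0 < -S u v w (hat q) := by linarith [S_hat_neg hL hS h1 h2 h3]
    exact core h2 h3 h1 hK hA (spoke_uq hL u v w q p) (spoke_qu hL u v w q p)
      (spoke_vq hL u v w q p) (spoke_qv hL u v w q p) (spoke_wq hL u v w q p)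
      (spoke_qw hL u v w q p) (sphere_uvq hL hS u v w q p) (sphere_vwq hL hS u v w q p)
      (sphere_wuq hL hS u v w q p) hσ hu hv hw
  · simp only [ht, false_and, or_self]

end Pointwise

/-! ## §3 The scaffold is null -/
section Scaffold

/-- A linear polynomial `a X₀ + b X₁ + c` in the three coordinates. -/
def linPoly (a b c : ℝ) : MvPolynomial (Fin 3) ℝ := C a * X 0 + C b * X 1 + C c

lemma eval_linPoly (a b c : ℝ) (p : Fin 3 → ℝ) :
    eval p (linPoly a b c) = a * p 0 + b * p 1 + c := by
  simp [linPoly]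

/-- A sphere polynomial `(X₀² + X₁² + X₂²) c₁ − X₀ c₂ + X₁ c₃ − c₄` (the shape of `S u v w`). -/
def sphPoly (c₁ c₂ c₃ c₄ : ℝ) : MvPolynomial (Fin 3) ℝ :=
  (X 0 ^ 2 + X 1 ^ 2 + X 2 ^ 2) * C c₁ - X 0 * C c₂ + X 1 * C c₃ - C c₄

lemma eval_sphPoly (c₁ c₂ c₃ c₄ : ℝ) (p : Fin 3 → ℝ) :
    eval p (sphPoly c₁ c₂ c₃ c₄) = (p 0 ^ 2 + p 1 ^ 2 + p 2 ^ 2) * c₁ - p 0 * c₂ + p 1 * c₃ - c₄ := by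
  simp [sphPoly]

variable {L : ℂ → ℂ → (Fin 3 → ℝ) → ℝ} {S : ℂ → ℂ → ℂ → (Fin 3 → ℝ) → ℝ}
variable (hL : ∀ u v p, L u v p = (v.re - u.re) * (p 1 - u.im) - (v.im - u.im) * (p 0 - u.re))
  (hS : ∀ u v w p, S u v w p = (p 0 ^ 2 + p 1 ^ 2 + p 2 ^ 2) * (u.re * (v.im - w.im) - u.im * (v.re - w.re) + (v.re * w.im - v.im * w.re)) - p 0 * (Complex.normSq u * (v.im - w.im) - u.im * (Complex.normSq v - Complex.normSq w) + (Complex.normSq v * w.im - v.im * Complex.normSq w)) + p 1 * (Complex.normSq u * (v.re - w.re) - u.re * (Complex.normSq v - Complex.normSq w) + (Complex.normSq v * w.re - v.re * Complex.normSq w)) - (Complex.normSq u * (v.re * w.im - v.im * w.re) - u.re * (Complex.normSq v * w.im - v.im * Complex.normSq w) + u.im * (Complex.normSq v * w.re - v.re * Complex.normSq w)))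

include hL in
/-- A vertical plane `{L u q = 0}` which misses one point is Lebesgue-null. -/
theorem volume_setOf_L_eq_zero {u q : ℂ} {p₀ : Fin 3 → ℝ} (h : L u q p₀ ≠ 0) :
    volume {p : Fin 3 → ℝ | L u q p = 0} = 0 := by
  set P := linPoly (-(q.im - u.im)) (q.re - u.re) ((q.im - u.im) * u.re - (q.re - u.re) * u.im)
    with hP_def
  have hev : ∀ p, eval p P = L u q p := fun p => by rw [hP_def, eval_linPoly, hL]; ring
  have hP : P ≠ 0 := fun h0 => h (by rw [← hev, h0, map_zero])
  have hset : {p : Fin 3 → ℝ | L u q p = 0} = {p | eval p P = 0} := by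
    ext p; rw [mem_setOf_eq, mem_setOf_eq, hev]
  rw [hset]
  exact MvPolynomial.volume_zeroSet_eq_zero 3 P hP

include hS in
/-- A sphere `{S u v w = 0}` which misses one point is Lebesgue-null. -/
theorem volume_setOf_S_eq_zero {u v w : ℂ} {p₀ : Fin 3 → ℝ} (h : S u v w p₀ ≠ 0) :
    volume {p : Fin 3 → ℝ | S u v w p = 0} = 0 := by
  set P := sphPoly (u.re * (v.im - w.im) - u.im * (v.re - w.re) + (v.re * w.im - v.im * w.re))
    (Complex.normSq u * (v.im - w.im) - u.im * (Complex.normSq v - Complex.normSq w) + (Complex.normSq v * w.im - v.im * Complex.normSq w))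
    (Complex.normSq u * (v.re - w.re) - u.re * (Complex.normSq v - Complex.normSq w) + (Complex.normSq v * w.re - v.re * Complex.normSq w))
    (Complex.normSq u * (v.re * w.im - v.im * w.re) - u.re * (Complex.normSq v * w.im - v.im * Complex.normSq w) + u.im * (Complex.normSq v * w.re - v.re * Complex.normSq w))
    with hP_def
  have hev : ∀ p, eval p P = S u v w p := fun p => by rw [hP_def, eval_sphPoly, hS]
  have hP : P ≠ 0 := fun h0 => h (by rw [← hev, h0, map_zero])
  have hset : {p : Fin 3 → ℝ | S u v w p = 0} = {p | eval p P = 0} := by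
    ext p; rw [mem_setOf_eq, mem_setOf_eq, hev]
  rw [hset]
  exact MvPolynomial.volume_zeroSet_eq_zero 3 P hP

include hL hS in
/-- **The scaffold of the 2–3 move is null**: the big sphere and the three spoke planes. -/
theorem volume_scaffold_eq_zero {u v w q : ℂ} (h1 : 0 < L u v (hat q)) (h2 : 0 < L v w (hat q))
    (h3 : 0 < L w u (hat q)) :
    volume {p : Fin 3 → ℝ | S u v w p = 0 ∨ L u q p = 0 ∨ L v q p = 0 ∨ L w q p = 0} = 0 := by
  have hSq : S u v w (hat q) ≠ 0 := (S_hat_neg hL hS h1 h2 h3).ne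
  have hu : L u q (hat w) ≠ 0 := by rw [L_uq_hat_w hL]; exact h3.ne'
  have hv : L v q (hat u) ≠ 0 := by rw [L_vq_hat_u hL]; exact h1.ne'
  have hw : L w q (hat v) ≠ 0 := by rw [L_wq_hat_v hL]; exact h2.ne'
  simp only [setOf_or]
  exact measure_union_null (volume_setOf_S_eq_zero hS hSq)
    (measure_union_null (volume_setOf_L_eq_zero hL hu)
      (measure_union_null (volume_setOf_L_eq_zero hL hv) (volume_setOf_L_eq_zero hL hw)))

end Scaffold

/-! ## §4 The crux is TRUE -/
section Crux

/-- Iterated domain additivity over an almost-partition into three pieces (the tree's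
`KZ.of_sub_sum_of_mem_relations` specialised to `Fin 3`). -/
theorem of_sub_three_mem_relations {n : ℕ} (r R₁ R₂ R₃ : KZ.IntegralRep n)
    (hd₁ : volume (R₁.domain \ r.domain) = 0) (hd₂ : volume (R₂.domain \ r.domain) = 0)
    (hd₃ : volume (R₃.domain \ r.domain) = 0)
    (hi₁ : EqOn R₁.integrand r.integrand (R₁.domain ∩ r.domain))
    (hi₂ : EqOn R₂.integrand r.integrand (R₂.domain ∩ r.domain))
    (hi₃ : EqOn R₃.integrand r.integrand (R₃.domain ∩ r.domain))
    (hcov : volume (r.domain \ (R₁.domain ∪ R₂.domain ∪ R₃.domain)) = 0)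
    (h12 : volume (R₁.domain ∩ R₂.domain) = 0) (h13 : volume (R₁.domain ∩ R₃.domain) = 0)
    (h23 : volume (R₂.domain ∩ R₃.domain) = 0) :
    KZ.of r - KZ.of R₁ - KZ.of R₂ - KZ.of R₃ ∈ KZ.relations := by
  set R : Fin 3 → KZ.IntegralRep n := ![R₁, R₂, R₃] with hR
  have h := KZ.of_sub_sum_of_mem_relations (Finset.univ : Finset (Fin 3)) r R
    (fun i _ => by fin_cases i <;> simpa [hR] using by assumption)
    (fun i _ => by fin_cases i <;> simpa [hR] using by assumption)
    (by
      have : (⋃ i ∈ (Finset.univ : Finset (Fin 3)), (R i).domain) =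
          R₁.domain ∪ R₂.domain ∪ R₃.domain := by
        ext p
        simp only [Finset.mem_univ, iUnion_true, mem_iUnion, mem_union, hR]
        constructor
        · rintro ⟨i, hi⟩
          fin_cases i
          · exact Or.inl (Or.inl (by simpa using hi))
          · exact Or.inl (Or.inr (by simpa using hi))
          · exact Or.inr (by simpa using hi)
        · rintro ((hi | hi) | hi)
          · exact ⟨0, by simpa using hi⟩
          · exact ⟨1, by simpa using hi⟩
          · exact ⟨2, by simpa using hi⟩
      rw [this]; exact hcov)
    (by
      intro i _ j _ hij
      fin_cases i <;> fin_cases j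
      · exact absurd rfl hij
      · simpa [hR] using h12
      · simpa [hR] using h13
      · simpa [hR, inter_comm] using h12
      · exact absurd rfl hij
      · simpa [hR] using h23
      · simpa [hR, inter_comm] using h13
      · simpa [hR, inter_comm] using h23
      · exact absurd rfl hij)
  have hsum : ∑ i ∈ (Finset.univ : Finset (Fin 3)), KZ.of (R i) = KZ.of R₁ + KZ.of R₂ + KZ.of R₃ := by
    rw [Fin.sum_univ_three]; simp [hR]
  rw [hsum] at h
  have e : KZ.of r - KZ.of R₁ - KZ.of R₂ - KZ.of R₃ = KZ.of r - (KZ.of R₁ + KZ.of R₂ + KZ.of R₃) := by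
    abel
  rw [e]; exact h

variable {L : ℂ → ℂ → (Fin 3 → ℝ) → ℝ} {S : ℂ → ℂ → ℂ → (Fin 3 → ℝ) → ℝ}
variable (hL : ∀ u v p, L u v p = (v.re - u.re) * (p 1 - u.im) - (v.im - u.im) * (p 0 - u.re))
  (hS : ∀ u v w p, S u v w p = (p 0 ^ 2 + p 1 ^ 2 + p 2 ^ 2) * (u.re * (v.im - w.im) - u.im * (v.re - w.re) + (v.re * w.im - v.im * w.re)) - p 0 * (Complex.normSq u * (v.im - w.im) - u.im * (Complex.normSq v - Complex.normSq w) + (Complex.normSq v * w.im - v.im * Complex.normSq w)) + p 1 * (Complex.normSq u * (v.re - w.re) - u.re * (Complex.normSq v - Complex.normSq w) + (Complex.normSq v * w.re - v.re * Complex.normSq w)) - (Complex.normSq u * (v.re * w.im - v.im * w.re) - u.re * (Complex.normSq v * w.im - v.im * Complex.normSq w) + u.im * (Complex.normSq v * w.re - v.re * Complex.normSq w)))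
include hL hS

/-- **The 2–3 move is a KZ relation — general form.**  No algebraicity of `u v w q` and no
particular integrand is needed: for ANY five representations on the five typed domains whose
integrands agree with one common function `f` on their domains,
`[rP] + [rI] − [r₁] − [r₂] − [r₃] ∈ KZ.relations`.  Moves used: one `domainAddRel` (glue `rP`,
`rI`, disjoint) and the tree's iterated domain additivity over the almost-partition `r₁, r₂, r₃`
of the glued domain (overlaps and defects lie in the null scaffold of §3). -/
theorem pachnerTwoThree_general {u v w q : ℂ} (h1 : 0 < L u v (hat q))
    (h2 : 0 < L v w (hat q)) (h3 : 0 < L w u (hat q)) (f : (Fin 3 → ℝ) → ℝ)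
    (rP rI r₁ r₂ r₃ : KZ.IntegralRep 3)
    (hP : rP.domain = {p | 0 < p 2 ∧ 0 < L u v p ∧ 0 < L v w p ∧ 0 < L w u p ∧ 0 < S u v w p})
    (hI : rI.domain = {p | 0 < p 2 ∧ S u v w p < 0 ∧ 0 < S u v q p ∧ 0 < S v w q p ∧ 0 < S w u q p})
    (hr₁ : r₁.domain = {p | 0 < p 2 ∧ 0 < L u v p ∧ 0 < L v q p ∧ 0 < L q u p ∧ 0 < S u v q p})
    (hr₂ : r₂.domain = {p | 0 < p 2 ∧ 0 < L v w p ∧ 0 < L w q p ∧ 0 < L q v p ∧ 0 < S v w q p})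
    (hr₃ : r₃.domain = {p | 0 < p 2 ∧ 0 < L w u p ∧ 0 < L u q p ∧ 0 < L q w p ∧ 0 < S w u q p})
    (fP : EqOn rP.integrand f rP.domain) (fI : EqOn rI.integrand f rI.domain)
    (f₁ : EqOn r₁.integrand f r₁.domain) (f₂ : EqOn r₂.integrand f r₂.domain)
    (f₃ : EqOn r₃.integrand f r₃.domain) :
    KZ.of rP + KZ.of rI - KZ.of r₁ - KZ.of r₂ - KZ.of r₃ ∈ KZ.relations := by
  -- the null scaffold and the pointwise identity off it
  set Z : Set (Fin 3 → ℝ) := {p | S u v w p = 0 ∨ L u q p = 0 ∨ L v q p = 0 ∨ L w q p = 0}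
    with hZ_def
  have hZ : volume Z = 0 := volume_scaffold_eq_zero hL hS h1 h2 h3
  have hpt : ∀ p, p ∉ Z → ((p ∈ rP.domain ∨ p ∈ rI.domain) ↔
      (p ∈ r₁.domain ∨ p ∈ r₂.domain ∨ p ∈ r₃.domain)) := by
    intro p hp
    simp only [hZ_def, mem_setOf_eq, not_or] at hp
    rw [hP, hI, hr₁, hr₂, hr₃]
    simp only [mem_setOf_eq]
    exact two_three_pointwise hL hS h1 h2 h3 hp.1 hp.2.1 hp.2.2.1 hp.2.2.2
  -- glue rP and rI
  have hdisj : Disjoint rP.domain rI.domain := by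
    rw [Set.disjoint_left]
    intro p hp hp'
    rw [hP] at hp
    rw [hI] at hp'
    exact absurd hp.2.2.2.2 (not_lt.mpr hp'.2.1.le)
  set r := rP.glue rI hdisj with hr_def
  have hglue : KZ.of r - KZ.of rP - KZ.of rI ∈ KZ.relations :=
    KZ.domainAddRel_subset_relations (KZ.IntegralRep.of_glue_sub_sub_mem_domainAddRel rP rI hdisj)
  have hrdom : r.domain = rP.domain ∪ rI.domain := rfl
  have hrint : EqOn r.integrand f r.domain := by
    intro p hp
    rcases hp with hp | hp
    · rw [KZ.IntegralRep.eqOn_integrand_glue_left rP rI hdisj hp]; exact fP hp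
    · rw [KZ.IntegralRep.eqOn_integrand_glue_right rP rI hdisj hp]; exact fI hp
  -- a.e. inclusions via the scaffold
  have sub₁ : r₁.domain \ r.domain ⊆ Z := by
    intro p hp
    by_contra hz
    exact hp.2 ((hpt p hz).mpr (Or.inl hp.1))
  have sub₂ : r₂.domain \ r.domain ⊆ Z := by
    intro p hp
    by_contra hz
    exact hp.2 ((hpt p hz).mpr (Or.inr (Or.inl hp.1)))
  have sub₃ : r₃.domain \ r.domain ⊆ Z := by
    intro p hp
    by_contra hz
    exact hp.2 ((hpt p hz).mpr (Or.inr (Or.inr hp.1)))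
  have subc : r.domain \ (r₁.domain ∪ r₂.domain ∪ r₃.domain) ⊆ Z := by
    intro p hp
    by_contra hz
    have := (hpt p hz).mp hp.1
    rcases this with h | h | h
    · exact hp.2 (Or.inl (Or.inl h))
    · exact hp.2 (Or.inl (Or.inr h))
    · exact hp.2 (Or.inr h)
  -- pairwise disjointness of the three prisms
  have e12 : r₁.domain ∩ r₂.domain = ∅ := by
    ext p
    simp only [mem_inter_iff, mem_empty_iff_false, iff_false, not_and]
    intro hp hp'
    rw [hr₁] at hp
    rw [hr₂] at hp'
    have := L_anti hL v q p
    linarith [hp.2.2.1, hp'.2.2.2.1]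
  have e13 : r₁.domain ∩ r₃.domain = ∅ := by
    ext p
    simp only [mem_inter_iff, mem_empty_iff_false, iff_false, not_and]
    intro hp hp'
    rw [hr₁] at hp
    rw [hr₃] at hp'
    have := L_anti hL u q p
    linarith [hp.2.2.2.1, hp'.2.2.1]
  have e23 : r₂.domain ∩ r₃.domain = ∅ := by
    ext p
    simp only [mem_inter_iff, mem_empty_iff_false, iff_false, not_and]
    intro hp hp'
    rw [hr₂] at hp
    rw [hr₃] at hp'
    have := L_anti hL w q p
    linarith [hp.2.2.1, hp'.2.2.2.1]
  have hsplit : KZ.of r - KZ.of r₁ - KZ.of r₂ - KZ.of r₃ ∈ KZ.relations :=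
    of_sub_three_mem_relations r r₁ r₂ r₃ (measure_mono_null sub₁ hZ)
      (measure_mono_null sub₂ hZ) (measure_mono_null sub₃ hZ)
      (fun p hp => by rw [f₁ hp.1, hrint hp.2]) (fun p hp => by rw [f₂ hp.1, hrint hp.2])
      (fun p hp => by rw [f₃ hp.1, hrint hp.2]) (measure_mono_null subc hZ)
      (by rw [e12, measure_empty]) (by rw [e13, measure_empty]) (by rw [e23, measure_empty])
  have e : KZ.of rP + KZ.of rI - KZ.of r₁ - KZ.of r₂ - KZ.of r₃ =
      (KZ.of r - KZ.of r₁ - KZ.of r₂ - KZ.of r₃) - (KZ.of r - KZ.of rP - KZ.of rI) := by abel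
  rw [e]
  exact KZ.relations.sub_mem hsplit hglue

end Crux

/-! ## §4b The convex configuration: the CORRECT relation when `q` crosses the edge `uv`

When the first interior hypothesis fails — `L u v q̂ < 0`, `q` still inside the circumcircle and
on the inner side of the other two edges, i.e. `u, q, v, w` in convex position with Delaunay
diagonal `qw` — the typed inner region is the ideal tetrahedron `T(u,q,v,w)` and the true 2–3
move reads `prism(u,v,w) + inner + prism(u,q,v) = prism(v,w,q) + prism(w,u,q)` (a.e.): the
typed `prism(u,v,q)` is EMPTY (clockwise) and the prism over the re-oriented triangle `(u,q,v)`
appears ON THE OTHER SIDE.  This is the repair line for the degenerate bipyramids and the source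
of the KZ-level counterexample of §5. -/
section Convex

/-- **Abstract core, convex configuration** (`γ < 0 < α, β`, `K > 0`). -/
theorem core_convex {α β γ K A a b c σ Luq Lqv Lvu Lwq Lqw Suvq Suqv Svwq Swuq : ℝ}
    (hα : 0 < α) (hβ : 0 < β) (hγ : γ < 0) (hK : 0 < K) (hA : 0 < A)
    (euq : A * Luq = β * c - γ * b) (eqv : A * Lqv = α * c - γ * a) (evu : Lvu = -c)
    (ewq : A * Lwq = α * b - β * a) (eqw : A * Lqw = β * a - α * b)
    (e₁ : A * Suvq = γ * σ + K * c) (eX : A * Suqv = -(γ * σ + K * c))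
    (e₂ : A * Svwq = α * σ + K * a) (e₃ : A * Swuq = β * σ + K * b)
    (hσ : σ ≠ 0) (hc : c ≠ 0) (h1 : Suvq ≠ 0) (hw : Lwq ≠ 0) :
    ((0 < c ∧ 0 < a ∧ 0 < b ∧ 0 < σ) ∨ (σ < 0 ∧ 0 < Suvq ∧ 0 < Svwq ∧ 0 < Swuq) ∨
      (0 < Luq ∧ 0 < Lqv ∧ 0 < Lvu ∧ 0 < Suqv)) ↔
    ((0 < a ∧ 0 < Lwq ∧ 0 < Lqv ∧ 0 < Svwq) ∨ (0 < b ∧ 0 < Luq ∧ 0 < Lqw ∧ 0 < Swuq)) := by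
  have t : ∀ {X Y : ℝ}, A * X = Y → (0 < X ↔ 0 < Y) := fun e => by
    rw [← e, mul_pos_iff_of_pos_left hA]
  have hs : γ * σ + K * c ≠ 0 := by rw [← e₁]; exact mul_ne_zero hA.ne' h1
  have h3 : α * b - β * a ≠ 0 := by rw [← ewq]; exact mul_ne_zero hA.ne' hw
  have hγ' : 0 < -γ := neg_pos.mpr hγ
  rw [t euq, t eqv, evu, t ewq, t eqw, t e₁, t eX, t e₂, t e₃]
  constructor
  · intro h
    -- common consequences: a, b > 0, the two mixed spokes and the two small spheres positive
    have key : 0 < a ∧ 0 < b ∧ 0 < α * c - γ * a ∧ 0 < β * c - γ * b ∧ 0 < α * σ + K * a ∧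
        0 < β * σ + K * b := by
      rcases h with ⟨hc', ha, hb, hs'⟩ | ⟨hs', k1, k2, k3⟩ | ⟨x1, x2, x3, x4⟩
      · have := mul_pos hα hc'
        have := mul_pos hβ hc'
        have := mul_pos hγ' ha
        have := mul_pos hγ' hb
        have := mul_pos hα hs'
        have := mul_pos hβ hs'
        have := mul_pos hK ha
        have := mul_pos hK hb
        refine ⟨ha, hb, by linarith, by linarith, by linarith, by linarith⟩
      · have hασ : α * σ < 0 := mul_neg_of_pos_of_neg hα hs'
        have hβσ : β * σ < 0 := mul_neg_of_pos_of_neg hβ hs'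
        have ha : 0 < a := pos_of_mul_pos_right (by linarith) hK.le
        have hb : 0 < b := pos_of_mul_pos_right (by linarith) hK.le
        refine ⟨ha, hb, ?_, ?_, k2, k3⟩
        · have e : K * (α * c - γ * a) = α * (γ * σ + K * c) + (-γ) * (α * σ + K * a) := by ring
          have : 0 < K * (α * c - γ * a) := by rw [e]; exact add_pos (mul_pos hα k1) (mul_pos hγ' k2)
          exact pos_of_mul_pos_right this hK.le
        · have e : K * (β * c - γ * b) = β * (γ * σ + K * c) + (-γ) * (β * σ + K * b) := by ring
          have : 0 < K * (β * c - γ * b) := by rw [e]; exact add_pos (mul_pos hβ k1) (mul_pos hγ' k3)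
          exact pos_of_mul_pos_right this hK.le
      · have ha : 0 < a := by
          have e : (-γ) * a = (α * c - γ * a) + α * (-c) := by ring
          have : 0 < (-γ) * a := by rw [e]; exact add_pos x2 (mul_pos hα x3)
          exact pos_of_mul_pos_right this hγ'.le
        have hb : 0 < b := by
          have e : (-γ) * b = (β * c - γ * b) + β * (-c) := by ring
          have : 0 < (-γ) * b := by rw [e]; exact add_pos x1 (mul_pos hβ x3)
          exact pos_of_mul_pos_right this hγ'.le
        refine ⟨ha, hb, x2, x1, ?_, ?_⟩
        · have e : (-γ) * (α * σ + K * a) = K * (α * c - γ * a) + α * (-(γ * σ + K * c)) := by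
            ring
          have : 0 < (-γ) * (α * σ + K * a) := by rw [e]; exact add_pos (mul_pos hK x2) (mul_pos hα x4)
          exact pos_of_mul_pos_right this hγ'.le
        · have e : (-γ) * (β * σ + K * b) = K * (β * c - γ * b) + β * (-(γ * σ + K * c)) := by
            ring
          have : 0 < (-γ) * (β * σ + K * b) := by rw [e]; exact add_pos (mul_pos hK x1) (mul_pos hβ x4)
          exact pos_of_mul_pos_right this hγ'.le
    obtain ⟨ha, hb, m1, m2, s2, s3⟩ := key
    rcases lt_or_gt_of_ne h3 with k | k
    · exact Or.inr ⟨hb, m2, by linarith, s3⟩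
    · exact Or.inl ⟨ha, k, m1, s2⟩
  · intro h
    rcases h with ⟨ha, w1, w2, s2⟩ | ⟨hb, w1, w2, s3⟩
    · have hb : 0 < b := by
        have : 0 < α * b := by linarith [mul_pos hβ ha]
        exact pos_of_mul_pos_right this hα.le
      have s3 : 0 < β * σ + K * b := by
        have e : α * (β * σ + K * b) = β * (α * σ + K * a) + K * (α * b - β * a) := by ring
        have : 0 < α * (β * σ + K * b) := by rw [e]; exact add_pos (mul_pos hβ s2) (mul_pos hK w1)
        exact pos_of_mul_pos_right this hα.le
      rcases lt_or_gt_of_ne hc with kc | kc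
      · rcases lt_or_gt_of_ne hs with ks | ks
        · refine Or.inr (Or.inr ⟨?_, w2, by linarith, by linarith⟩)
          have e : α * (β * c - γ * b) = β * (α * c - γ * a) + (-γ) * (α * b - β * a) := by ring
          have : 0 < α * (β * c - γ * b) := by rw [e]; exact add_pos (mul_pos hβ w2) (mul_pos hγ' w1)
          exact pos_of_mul_pos_right this hα.le
        · have hKc : K * c < 0 := mul_neg_of_pos_of_neg hK kc
          have hγσ : 0 < γ * σ := by linarith
          have hσ' : σ < 0 := by
            rcases pos_and_pos_or_neg_and_neg_of_mul_pos hγσ with ⟨h₁, _⟩ | ⟨_, h₂⟩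
            · exact absurd h₁ (not_lt.mpr hγ.le)
            · exact h₂
          exact Or.inr (Or.inl ⟨hσ', ks, s2, s3⟩)
      · rcases lt_or_gt_of_ne hσ with kσ | kσ
        · have : 0 < γ * σ := mul_pos_of_neg_of_neg hγ kσ
          have : 0 < K * c := mul_pos hK kc
          exact Or.inr (Or.inl ⟨kσ, by linarith, s2, s3⟩)
        · exact Or.inl ⟨kc, ha, hb, kσ⟩
    · have ha : 0 < a := by
        have : 0 < β * a := by linarith [mul_pos hα hb]
        exact pos_of_mul_pos_right this hβ.le
      have s2 : 0 < α * σ + K * a := by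
        have e : β * (α * σ + K * a) = α * (β * σ + K * b) + K * (β * a - α * b) := by ring
        have : 0 < β * (α * σ + K * a) := by rw [e]; exact add_pos (mul_pos hα s3) (mul_pos hK w2)
        exact pos_of_mul_pos_right this hβ.le
      rcases lt_or_gt_of_ne hc with kc | kc
      · rcases lt_or_gt_of_ne hs with ks | ks
        · refine Or.inr (Or.inr ⟨w1, ?_, by linarith, by linarith⟩)
          have e : β * (α * c - γ * a) = α * (β * c - γ * b) + (-γ) * (β * a - α * b) := by ring
          have : 0 < β * (α * c - γ * a) := by rw [e]; exact add_pos (mul_pos hα w1) (mul_pos hγ' w2)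
          exact pos_of_mul_pos_right this hβ.le
        · have hKc : K * c < 0 := mul_neg_of_pos_of_neg hK kc
          have hγσ : 0 < γ * σ := by linarith
          have hσ' : σ < 0 := by
            rcases pos_and_pos_or_neg_and_neg_of_mul_pos hγσ with ⟨h₁, _⟩ | ⟨_, h₂⟩
            · exact absurd h₁ (not_lt.mpr hγ.le)
            · exact h₂
          exact Or.inr (Or.inl ⟨hσ', ks, s2, s3⟩)
      · rcases lt_or_gt_of_ne hσ with kσ | kσ
        · have : 0 < γ * σ := mul_pos_of_neg_of_neg hγ kσ
          have : 0 < K * c := mul_pos hK kc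
          exact Or.inr (Or.inl ⟨kσ, by linarith, s2, s3⟩)
        · exact Or.inl ⟨kc, ha, hb, kσ⟩

variable {L : ℂ → ℂ → (Fin 3 → ℝ) → ℝ} {S : ℂ → ℂ → ℂ → (Fin 3 → ℝ) → ℝ}
variable (hL : ∀ u v p, L u v p = (v.re - u.re) * (p 1 - u.im) - (v.im - u.im) * (p 0 - u.re))
  (hS : ∀ u v w p, S u v w p = (p 0 ^ 2 + p 1 ^ 2 + p 2 ^ 2) * (u.re * (v.im - w.im) - u.im * (v.re - w.re) + (v.re * w.im - v.im * w.re)) - p 0 * (Complex.normSq u * (v.im - w.im) - u.im * (Complex.normSq v - Complex.normSq w) + (Complex.normSq v * w.im - v.im * Complex.normSq w)) + p 1 * (Complex.normSq u * (v.re - w.re) - u.re * (Complex.normSq v - Complex.normSq w) + (Complex.normSq v * w.re - v.re * Complex.normSq w)) - (Complex.normSq u * (v.re * w.im - v.im * w.re) - u.re * (Complex.normSq v * w.im - v.im * Complex.normSq w) + u.im * (Complex.normSq v * w.re - v.re * Complex.normSq w)))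

include hL in
/-- The double area `A = α + β + γ` is the edge form of `w` along `uv`. -/
theorem L_sum_hat (u v w q : ℂ) :
    L u v (hat q) + L v w (hat q) + L w u (hat q) = L u v (hat w) := by
  simp only [hL, hat_zero, hat_one]; ring

include hL hS in
/-- The re-oriented small sphere: `A · S u q v = −(γ · S u v w + K · L u v)`. -/
theorem sphere_uqv (u v w q : ℂ) (p : Fin 3 → ℝ) :
    (L u v (hat q) + L v w (hat q) + L w u (hat q)) * S u q v p
      = -(L u v (hat q) * S u v w p + (-S u v w (hat q)) * L u v p) := by
  simp only [hL, hS, hat_zero, hat_one, hat_two, Complex.normSq_apply]; ring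

include hS in
/-- Swapping the moving point with the inner point: `S u v w q̂ = −S u v q ŵ`. -/
theorem S_hat_swap (u v w q : ℂ) : S u v w (hat q) = -S u v q (hat w) := by
  simp only [hS, hat_zero, hat_one, hat_two, Complex.normSq_apply]; ring

include hL hS in
/-- **Pointwise 2–3 identity, convex configuration** (`q` across the edge `uv`, inside the
circumcircle): off the scaffold `{S u v w = 0} ∪ {L u v = 0} ∪ {S u v q = 0} ∪ {L w q = 0}`,
`p ∈ prism(u,v,w) ∪ inner ∪ prism(u,q,v) ⇔ p ∈ prism(v,w,q) ∪ prism(w,u,q)`. -/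
theorem two_three_pointwise_convex {u v w q : ℂ} (hγ : L u v (hat q) < 0)
    (hα : 0 < L v w (hat q)) (hβ : 0 < L w u (hat q)) (hK : S u v w (hat q) < 0)
    (hA : 0 < L u v (hat q) + L v w (hat q) + L w u (hat q)) {p : Fin 3 → ℝ}
    (hσ : S u v w p ≠ 0) (hc : L u v p ≠ 0) (h1 : S u v q p ≠ 0) (hw : L w q p ≠ 0) :
    ((0 < p 2 ∧ 0 < L u v p ∧ 0 < L v w p ∧ 0 < L w u p ∧ 0 < S u v w p) ∨
      (0 < p 2 ∧ S u v w p < 0 ∧ 0 < S u v q p ∧ 0 < S v w q p ∧ 0 < S w u q p) ∨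
      (0 < p 2 ∧ 0 < L u q p ∧ 0 < L q v p ∧ 0 < L v u p ∧ 0 < S u q v p)) ↔
    ((0 < p 2 ∧ 0 < L v w p ∧ 0 < L w q p ∧ 0 < L q v p ∧ 0 < S v w q p) ∨
      (0 < p 2 ∧ 0 < L w u p ∧ 0 < L u q p ∧ 0 < L q w p ∧ 0 < S w u q p)) := by
  by_cases ht : 0 < p 2
  · simp only [ht, true_and]
    have hK' : 0 < -S u v w (hat q) := by linarith
    exact core_convex hα hβ hγ hK' hA (spoke_uq hL u v w q p) (spoke_qv hL u v w q p)
      (L_anti hL u v p) (spoke_wq hL u v w q p) (spoke_qw hL u v w q p)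
      (sphere_uvq hL hS u v w q p) (sphere_uqv hL hS u v w q p) (sphere_vwq hL hS u v w q p)
      (sphere_wuq hL hS u v w q p) hσ hc h1 hw
  · simp only [ht, false_and, or_self]

include hL hS in
/-- The scaffold of the convex configuration is null. -/
theorem volume_scaffold_convex_eq_zero {u v w q : ℂ} (hα : 0 < L v w (hat q))
    (hK : S u v w (hat q) < 0) (hA : 0 < L u v (hat q) + L v w (hat q) + L w u (hat q)) :
    volume {p : Fin 3 → ℝ | S u v w p = 0 ∨ L u v p = 0 ∨ S u v q p = 0 ∨ L w q p = 0} = 0 := by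
  have hSq : S u v w (hat q) ≠ 0 := hK.ne
  have huv : L u v (hat w) ≠ 0 := by rw [← L_sum_hat hL u v w q]; exact hA.ne'
  have hS1 : S u v q (hat w) ≠ 0 := by
    have := S_hat_swap hS u v w q
    intro h0; rw [h0, neg_zero] at this; exact hSq this
  have hw : L w q (hat v) ≠ 0 := by rw [L_wq_hat_v hL]; exact hα.ne'
  simp only [setOf_or]
  exact measure_union_null (volume_setOf_S_eq_zero hS hSq)
    (measure_union_null (volume_setOf_L_eq_zero hL huv)
      (measure_union_null (volume_setOf_S_eq_zero hS hS1) (volume_setOf_L_eq_zero hL hw)))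

include hL hS in
/-- **The correct 2–3 relation in the convex configuration.**  If `q̂` lies across the edge
`uv` (`L u v q̂ < 0`), on the inner side of `vw` and `wu`, inside the circumcircle
(`S u v w q̂ < 0`) of the counter-clockwise triangle (`0 < A`), then for any representations on
the typed domains with a common integrand
`[prism(u,v,w)] + [inner] + [prism(u,q,v)] − [prism(v,w,q)] − [prism(w,u,q)] ∈ KZ.relations`:
the prism over the RE-ORIENTED triangle `(u, q, v)` sits on the LEFT, while the typed
`prism(u,v,q)` is empty. -/
theorem pachnerTwoThree_convex_general {u v w q : ℂ} (hγ : L u v (hat q) < 0)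
    (hα : 0 < L v w (hat q)) (hβ : 0 < L w u (hat q)) (hK : S u v w (hat q) < 0)
    (hA : 0 < L u v (hat q) + L v w (hat q) + L w u (hat q)) (f : (Fin 3 → ℝ) → ℝ)
    (rP rI rX r₂ r₃ : KZ.IntegralRep 3)
    (hP : rP.domain = {p | 0 < p 2 ∧ 0 < L u v p ∧ 0 < L v w p ∧ 0 < L w u p ∧ 0 < S u v w p})
    (hI : rI.domain = {p | 0 < p 2 ∧ S u v w p < 0 ∧ 0 < S u v q p ∧ 0 < S v w q p ∧ 0 < S w u q p})
    (hX : rX.domain = {p | 0 < p 2 ∧ 0 < L u q p ∧ 0 < L q v p ∧ 0 < L v u p ∧ 0 < S u q v p})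
    (hr₂ : r₂.domain = {p | 0 < p 2 ∧ 0 < L v w p ∧ 0 < L w q p ∧ 0 < L q v p ∧ 0 < S v w q p})
    (hr₃ : r₃.domain = {p | 0 < p 2 ∧ 0 < L w u p ∧ 0 < L u q p ∧ 0 < L q w p ∧ 0 < S w u q p})
    (fP : EqOn rP.integrand f rP.domain) (fI : EqOn rI.integrand f rI.domain)
    (fX : EqOn rX.integrand f rX.domain) (f₂ : EqOn r₂.integrand f r₂.domain)
    (f₃ : EqOn r₃.integrand f r₃.domain) :
    KZ.of rP + KZ.of rI + KZ.of rX - KZ.of r₂ - KZ.of r₃ ∈ KZ.relations := by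
  set Z : Set (Fin 3 → ℝ) := {p | S u v w p = 0 ∨ L u v p = 0 ∨ S u v q p = 0 ∨ L w q p = 0}
    with hZ_def
  have hZ : volume Z = 0 := volume_scaffold_convex_eq_zero hL hS hα hK hA
  have hpt : ∀ p, p ∉ Z → ((p ∈ rP.domain ∨ p ∈ rI.domain ∨ p ∈ rX.domain) ↔
      (p ∈ r₂.domain ∨ p ∈ r₃.domain)) := by
    intro p hp
    simp only [hZ_def, mem_setOf_eq, not_or] at hp
    rw [hP, hI, hX, hr₂, hr₃]
    simp only [mem_setOf_eq]
    exact two_three_pointwise_convex hL hS hγ hα hβ hK hA hp.1 hp.2.1 hp.2.2.1 hp.2.2.2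
  -- glue rP, rI, rX (pairwise disjoint)
  have hdisj : Disjoint rP.domain rI.domain := by
    rw [Set.disjoint_left]
    intro p hp hp'
    rw [hP] at hp
    rw [hI] at hp'
    exact absurd hp.2.2.2.2 (not_lt.mpr hp'.2.1.le)
  set r' := rP.glue rI hdisj with hr'_def
  have hdisj' : Disjoint r'.domain rX.domain := by
    rw [Set.disjoint_left]
    rintro p (hp | hp) hp'
    · rw [hP] at hp
      rw [hX] at hp'
      have := L_anti hL u v p
      linarith [hp.2.1, hp'.2.2.2.1]
    · rw [hI] at hp
      rw [hX] at hp'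
      have e := S_swap12 hS u q v p
      have e' := S_cyclic hS q u v p
      linarith [hp.2.2.1, hp'.2.2.2.2]
  set r := r'.glue rX hdisj' with hr_def
  have hglue₁ : KZ.of r' - KZ.of rP - KZ.of rI ∈ KZ.relations :=
    KZ.domainAddRel_subset_relations (KZ.IntegralRep.of_glue_sub_sub_mem_domainAddRel rP rI hdisj)
  have hglue₂ : KZ.of r - KZ.of r' - KZ.of rX ∈ KZ.relations :=
    KZ.domainAddRel_subset_relations (KZ.IntegralRep.of_glue_sub_sub_mem_domainAddRel r' rX hdisj')
  have hr'int : EqOn r'.integrand f r'.domain := by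
    intro p hp
    rcases hp with hp | hp
    · rw [KZ.IntegralRep.eqOn_integrand_glue_left rP rI hdisj hp]; exact fP hp
    · rw [KZ.IntegralRep.eqOn_integrand_glue_right rP rI hdisj hp]; exact fI hp
  have hrint : EqOn r.integrand f r.domain := by
    intro p hp
    rcases hp with hp | hp
    · rw [KZ.IntegralRep.eqOn_integrand_glue_left r' rX hdisj' hp]; exact hr'int hp
    · rw [KZ.IntegralRep.eqOn_integrand_glue_right r' rX hdisj' hp]; exact fX hp
  have hrdom : ∀ p, p ∈ r.domain ↔ (p ∈ rP.domain ∨ p ∈ rI.domain ∨ p ∈ rX.domain) := by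
    intro p
    change p ∈ (rP.domain ∪ rI.domain) ∪ rX.domain ↔ _
    simp only [mem_union, or_assoc]
  -- split r over r₂, r₃ (and an empty third piece)
  have sub₂ : r₂.domain \ r.domain ⊆ Z := by
    intro p hp
    by_contra hz
    exact hp.2 ((hrdom p).mpr ((hpt p hz).mpr (Or.inl hp.1)))
  have sub₃ : r₃.domain \ r.domain ⊆ Z := by
    intro p hp
    by_contra hz
    exact hp.2 ((hrdom p).mpr ((hpt p hz).mpr (Or.inr hp.1)))
  have subc : r.domain \ (r₂.domain ∪ r₃.domain ∪ (KZ.IntegralRep.empty 3).domain) ⊆ Z := by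
    intro p hp
    by_contra hz
    have := (hpt p hz).mp ((hrdom p).mp hp.1)
    rcases this with h | h
    · exact hp.2 (Or.inl (Or.inl h))
    · exact hp.2 (Or.inl (Or.inr h))
  have e23 : r₂.domain ∩ r₃.domain = ∅ := by
    ext p
    simp only [mem_inter_iff, mem_empty_iff_false, iff_false, not_and]
    intro hp hp'
    rw [hr₂] at hp
    rw [hr₃] at hp'
    have := L_anti hL w q p
    linarith [hp.2.2.1, hp'.2.2.2.1]
  have hsplit : KZ.of r - KZ.of r₂ - KZ.of r₃ - KZ.of (KZ.IntegralRep.empty 3) ∈ KZ.relations :=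
    of_sub_three_mem_relations r r₂ r₃ (KZ.IntegralRep.empty 3) (measure_mono_null sub₂ hZ)
      (measure_mono_null sub₃ hZ) (by simp)
      (fun p hp => by rw [f₂ hp.1, hrint hp.2]) (fun p hp => by rw [f₃ hp.1, hrint hp.2])
      (fun p hp => by simp at hp) (measure_mono_null subc hZ)
      (by rw [e23, measure_empty]) (by simp) (by simp)
  have hempty : KZ.of (KZ.IntegralRep.empty 3) ∈ KZ.relations :=
    KZ.IntegralRep.of_empty_mem_relations
  have e : KZ.of rP + KZ.of rI + KZ.of rX - KZ.of r₂ - KZ.of r₃ =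
      (KZ.of r - KZ.of r₂ - KZ.of r₃ - KZ.of (KZ.IntegralRep.empty 3)) +
      KZ.of (KZ.IntegralRep.empty 3) - (KZ.of r - KZ.of r' - KZ.of rX) -
      (KZ.of r' - KZ.of rP - KZ.of rI) := by abel
  rw [e]
  exact KZ.relations.sub_mem (KZ.relations.sub_mem (KZ.relations.add_mem hsplit hempty) hglue₂)
    hglue₁

end Convex

/-! ## §5 Negative knowledge

Concrete instances of the crux's `L`, `S`, `P` (`Lc`, `Sc`, `Pc`, `Ic`), the positive a.e. identity,
and the refutations: `not_exactUnion` (the unions are NOT equal as sets — the crux is not two bare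
`domainAddRel` moves), `not_aeIdentityWithoutInterior₁` (dropping `0 < L u v q̂` kills the a.e.
identity: witness configuration `C₂ = (−5, 5, 5i, −2i)`, `q` below the edge `uv` inside the
circumcircle; the defect is the whole prism over the clockwise triangle `(u, v, q)`). -/
section Concrete

/-- The crux's left-of test, as a function. -/
def Lc (u v : ℂ) (p : Fin 3 → ℝ) : ℝ := (v.re - u.re) * (p 1 - u.im) - (v.im - u.im) * (p 0 - u.re)

/-- The crux's circumsphere determinant, as a function. -/
def Sc (u v w : ℂ) (p : Fin 3 → ℝ) : ℝ := (p 0 ^ 2 + p 1 ^ 2 + p 2 ^ 2) * (u.re * (v.im - w.im) - u.im * (v.re - w.re) + (v.re * w.im - v.im * w.re)) - p 0 * (Complex.normSq u * (v.im - w.im) - u.im * (Complex.normSq v - Complex.normSq w) + (Complex.normSq v * w.im - v.im * Complex.normSq w)) + p 1 * (Complex.normSq u * (v.re - w.re) - u.re * (Complex.normSq v - Complex.normSq w) + (Complex.normSq v * w.re - v.re * Complex.normSq w)) - (Complex.normSq u * (v.re * w.im - v.im * w.re) - u.re * (Complex.normSq v * w.im - v.im * Complex.normSq w) + u.im * (Complex.normSq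 v * w.re - v.re * Complex.normSq w))

/-- The crux's prism `P u v w`. -/
def Pc (u v w : ℂ) : Set (Fin 3 → ℝ) :=
  {p | 0 < p 2 ∧ 0 < Lc u v p ∧ 0 < Lc v w p ∧ 0 < Lc w u p ∧ 0 < Sc u v w p}

/-- The crux's inner tetrahedron `(q; u, v, w)`. -/
def Ic (u v w q : ℂ) : Set (Fin 3 → ℝ) :=
  {p | 0 < p 2 ∧ Sc u v w p < 0 ∧ 0 < Sc u v q p ∧ 0 < Sc v w q p ∧ 0 < Sc w u q p}

theorem Lc_def : ∀ u v p, Lc u v p = (v.re - u.re) * (p 1 - u.im) - (v.im - u.im) * (p 0 - u.re) := fun _ _ _ => rfl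

theorem Sc_def : ∀ u v w p, Sc u v w p = (p 0 ^ 2 + p 1 ^ 2 + p 2 ^ 2) * (u.re * (v.im - w.im) - u.im * (v.re - w.re) + (v.re * w.im - v.im * w.re)) - p 0 * (Complex.normSq u * (v.im - w.im) - u.im * (Complex.normSq v - Complex.normSq w) + (Complex.normSq v * w.im - v.im * Complex.normSq w)) + p 1 * (Complex.normSq u * (v.re - w.re) - u.re * (Complex.normSq v - Complex.normSq w) + (Complex.normSq v * w.re - v.re * Complex.normSq w)) - (Complex.normSq u * (v.re * w.im - v.im * w.re) - u.re * (Complex.normSq v * w.im - v.im * Complex.normSq w) + u.im * (Complex.normSq v * w.re - v.re * Complex.normSq w)) := fun _ _ _ _ => rfl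

theorem Pc_def : ∀ u v w, Pc u v w = {p | 0 < p 2 ∧ 0 < Lc u v p ∧ 0 < Lc v w p ∧ 0 < Lc w u p ∧ 0 < Sc u v w p} :=
  fun _ _ _ => rfl

@[simp] theorem Lc_mk (a b c d : ℝ) (p : Fin 3 → ℝ) :
    Lc ⟨a, b⟩ ⟨c, d⟩ p = (c - a) * (p 1 - b) - (d - b) * (p 0 - a) := rfl

@[simp] theorem Sc_mk (a b c d e f : ℝ) (p : Fin 3 → ℝ) :
    Sc ⟨a, b⟩ ⟨c, d⟩ ⟨e, f⟩ p = (p 0 ^ 2 + p 1 ^ 2 + p 2 ^ 2) * (a * (d - f) - b * (c - e) + (c * f - d * e)) - p 0 * ((a * a + b * b) * (d - f) - b * ((c * c + d * d) - (e * e + f * f)) + ((c * c + d * d) * f - d * (e * e + f * f))) + p 1 * ((a * a + b * b) * (c - e) - a * ((c * c + d * d) - (e * e + f * f)) + ((c * c + d * d) * e - c * (e * e + f * f))) - ((a * a + b * b) * (c * f - d * e) - a * ((c * c + d * d) * f - d * (e * e + f * f)) + b * ((c * c + d * d) * e - c * (e * e + f * f))) := by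
  simp [Sc, Complex.normSq_mk]

/-- `i` is algebraic. -/
theorem isAlgebraic_I : IsAlgebraic ℚ Complex.I :=
  ⟨Polynomial.X ^ 2 + 1, Polynomial.Monic.ne_zero (by monicity!), by simp⟩

/-- Gaussian rationals are algebraic. -/
theorem isAlgebraic_mk_rat (a b : ℚ) : IsAlgebraic ℚ (⟨a, b⟩ : ℂ) := by
  have h : (⟨a, b⟩ : ℂ) = (a : ℂ) + (b : ℂ) * Complex.I := by
    apply Complex.ext <;> simp
  rw [h]
  exact (isAlgebraic_algebraMap (R := ℚ) (A := ℂ) a).add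
    ((isAlgebraic_algebraMap (R := ℚ) (A := ℂ) b).mul isAlgebraic_I)

theorem isAlgebraic_mk_int (a b : ℤ) : IsAlgebraic ℚ (⟨a, b⟩ : ℂ) := by
  have := isAlgebraic_mk_rat a b
  simpa using this

/-- Cyclic symmetry of the typed prism. -/
theorem Pc_cyclic (u v w : ℂ) : Pc v w u = Pc u v w := by
  ext p
  simp only [Pc, mem_setOf_eq, S_cyclic Sc_def u v w p]
  tauto

end Concrete

/-! ## §5b Non-vacuity infrastructure: every typed prism is a KZ representation

`prism(a, b, c) = Pc a b c` is the image of the tree's standard solid `idealTetrahedron z`,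
`z = (c − a)/(b − a)`, under the similarity `p ↦ (a + (b − a)·(p₀ + i p₁), |b − a|·p₂)` of `ℝ³`
(a hyperbolic isometry); hence `t⁻³` is integrable on it with integral `idealTetrahedronVolume z > 0`
(change of variables, Jacobian `|b − a|³`), and for algebraic vertices the prism is
`ℚ`-semialgebraic.  `prismRep a b c` is the resulting `KZ.IntegralRep 3` (this is also the first
half of the support item `IdealTetraRepExists`, stmt-3473). -/
section Prism

/-- Matrix of the linear part of the similarity attached to `e ∈ ℂ`. -/
def similMat (e : ℂ) : Matrix (Fin 3) (Fin 3) ℝ := !![e.re, -e.im, 0; e.im, e.re, 0; 0, 0, ‖e‖]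

/-- The linear part of the similarity, as a continuous linear map. -/
def similLin (e : ℂ) : (Fin 3 → ℝ) →L[ℝ] (Fin 3 → ℝ) :=
  LinearMap.toContinuousLinearMap (Matrix.toLin' (similMat e))

/-- The similarity `p ↦ (u + e·(p₀ + i p₁), ‖e‖·p₂)` of `ℝ³` (Poincaré extension of `ζ ↦ u + eζ`). -/
def simil (u e : ℂ) (p : Fin 3 → ℝ) : Fin 3 → ℝ := similLin e p + ![u.re, u.im, 0]

theorem similLin_apply (e : ℂ) (p : Fin 3 → ℝ) :
    similLin e p = ![e.re * p 0 - e.im * p 1, e.im * p 0 + e.re * p 1, ‖e‖ * p 2] := by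
  ext i
  simp only [similLin, LinearMap.coe_toContinuousLinearMap', Matrix.toLin'_apply, similMat,
    Matrix.mulVec, dotProduct, Fin.sum_univ_three]
  fin_cases i <;> simp
  all_goals ring

@[simp] theorem simil_apply_zero (u e : ℂ) (p : Fin 3 → ℝ) :
    simil u e p 0 = u.re + e.re * p 0 - e.im * p 1 := by
  simp [simil, similLin_apply]; ring

@[simp] theorem simil_apply_one (u e : ℂ) (p : Fin 3 → ℝ) :
    simil u e p 1 = u.im + e.im * p 0 + e.re * p 1 := by
  simp [simil, similLin_apply]; ring

@[simp] theorem simil_apply_two (u e : ℂ) (p : Fin 3 → ℝ) : simil u e p 2 = ‖e‖ * p 2 := by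
  simp [simil, similLin_apply]

theorem hasFDerivAt_simil (u e : ℂ) (p : Fin 3 → ℝ) : HasFDerivAt (simil u e) (similLin e) p :=
  (similLin e).hasFDerivAt.add_const _

theorem norm_sq_eq (e : ℂ) : ‖e‖ ^ 2 = e.re ^ 2 + e.im ^ 2 := by
  rw [Complex.sq_norm, Complex.normSq_apply]; ring

theorem det_similLin (e : ℂ) : (similLin e).det = ‖e‖ ^ 3 := by
  change LinearMap.det (Matrix.toLin' (similMat e)) = _
  rw [LinearMap.det_toLin']
  simp [similMat, Matrix.det_fin_three]
  have := norm_sq_eq e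
  linear_combination ‖e‖ * this.symm

theorem simil_injective (u : ℂ) {e : ℂ} (he : e ≠ 0) : Function.Injective (simil u e) := by
  intro p p' h
  have hn : 0 < e.re ^ 2 + e.im ^ 2 := by rw [← norm_sq_eq]; positivity
  have h0 := congrFun h 0
  have h1 := congrFun h 1
  have h2 := congrFun h 2
  simp only [simil_apply_zero, simil_apply_one, simil_apply_two] at h0 h1 h2
  have e0 : (e.re ^ 2 + e.im ^ 2) * (p 0 - p' 0) = 0 := by linear_combination e.re * h0 + e.im * h1
  have e1 : (e.re ^ 2 + e.im ^ 2) * (p 1 - p' 1) = 0 := by linear_combination -e.im * h0 + e.re * h1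
  have q0 : p 0 = p' 0 := by
    have := (mul_eq_zero.mp e0).resolve_left hn.ne'; linarith
  have q1 : p 1 = p' 1 := by
    have := (mul_eq_zero.mp e1).resolve_left hn.ne'; linarith
  have q2 : p 2 = p' 2 := mul_left_cancel₀ (norm_ne_zero_iff.mpr he) h2
  ext i; fin_cases i
  · exact q0
  · exact q1
  · exact q2

variable {u e z : ℂ}

theorem Lc_simil₁ (p : Fin 3 → ℝ) : Lc u (u + e) (simil u e p) = (e.re ^ 2 + e.im ^ 2) * p 1 := by
  simp only [Lc, simil_apply_zero, simil_apply_one, Complex.add_re, Complex.add_im]; ring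

theorem Lc_simil₂ (p : Fin 3 → ℝ) :
    Lc (u + e) (u + e * z) (simil u e p) = (e.re ^ 2 + e.im ^ 2) * ((z.re - 1) * p 1 - z.im * (p 0 - 1)) := by
  simp only [Lc, simil_apply_zero, simil_apply_one, Complex.add_re, Complex.add_im, Complex.mul_re,
    Complex.mul_im]; ring

theorem Lc_simil₃ (p : Fin 3 → ℝ) :
    Lc (u + e * z) u (simil u e p) = (e.re ^ 2 + e.im ^ 2) * (z.im * p 0 - z.re * p 1) := by
  simp only [Lc, simil_apply_zero, simil_apply_one, Complex.add_re, Complex.add_im, Complex.mul_re,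
    Complex.mul_im]; ring

theorem Sc_simil (p : Fin 3 → ℝ) :
    Sc u (u + e) (u + e * z) (simil u e p) = (e.re ^ 2 + e.im ^ 2) ^ 2 *
      (z.im * (p 0 ^ 2 + p 1 ^ 2 + p 2 ^ 2 - p 0) + (z.re - Complex.normSq z) * p 1) := by
  have hn := norm_sq_eq e
  simp only [Sc, simil_apply_zero, simil_apply_one, simil_apply_two, Complex.add_re, Complex.add_im,
    Complex.mul_re, Complex.mul_im, Complex.normSq_apply, mul_pow, hn]; ring

/-- Membership transport: `simil u e p ∈ prism(u, u+e, u+ez) ⇔ p ∈ idealTetrahedron z`. -/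
theorem simil_mem_Pc_iff (he : e ≠ 0) (p : Fin 3 → ℝ) :
    simil u e p ∈ Pc u (u + e) (u + e * z) ↔ p ∈ idealTetrahedron z := by
  have hn : 0 < e.re ^ 2 + e.im ^ 2 := by rw [← norm_sq_eq]; positivity
  have hN : 0 < ‖e‖ := norm_pos_iff.mpr he
  simp only [Pc, mem_setOf_eq, idealTetrahedron, simil_apply_two, Lc_simil₁, Lc_simil₂, Lc_simil₃,
    Sc_simil, mul_pos_iff_of_pos_left hN, mul_pos_iff_of_pos_left hn,
    mul_pos_iff_of_pos_left (pow_pos hn 2), sub_pos]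
  tauto

/-- The explicit inverse of the similarity. -/
def similInv (u e : ℂ) (P : Fin 3 → ℝ) : Fin 3 → ℝ :=
  ![(e.re * (P 0 - u.re) + e.im * (P 1 - u.im)) / (e.re ^ 2 + e.im ^ 2),
    (-e.im * (P 0 - u.re) + e.re * (P 1 - u.im)) / (e.re ^ 2 + e.im ^ 2), P 2 / ‖e‖]

theorem simil_similInv (he : e ≠ 0) (P : Fin 3 → ℝ) : simil u e (similInv u e P) = P := by
  have hn : e.re ^ 2 + e.im ^ 2 ≠ 0 := by rw [← norm_sq_eq]; positivity
  have hN : ‖e‖ ≠ 0 := norm_ne_zero_iff.mpr he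
  ext i
  fin_cases i
  · simp [similInv]; field_simp; ring
  · simp [similInv]; field_simp; ring
  · simp [similInv]; field_simp

/-- **The typed prism is the similar image of the standard ideal tetrahedron.** -/
theorem simil_image (he : e ≠ 0) : simil u e '' idealTetrahedron z = Pc u (u + e) (u + e * z) := by
  ext P
  constructor
  · rintro ⟨p, hp, rfl⟩
    exact (simil_mem_Pc_iff he p).mpr hp
  · intro hP
    refine ⟨similInv u e P, ?_, simil_similInv he P⟩
    rw [← simil_mem_Pc_iff he, simil_similInv he]
    exact hP

/-- The Jacobian factor cancels: `|det| · (‖e‖ t)⁻³ = t⁻³`. -/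
theorem jacobian_cancel (he : e ≠ 0) (x : Fin 3 → ℝ) :
    |(similLin e).det| • (1 / (simil u e x) 2 ^ 3) = 1 / x 2 ^ 3 := by
  have hN : 0 < ‖e‖ := norm_pos_iff.mpr he
  rw [det_similLin, simil_apply_two, smul_eq_mul, abs_of_pos (by positivity), mul_pow, one_div,
    one_div, mul_inv, ← mul_assoc, mul_inv_cancel₀ (pow_ne_zero 3 hN.ne'), one_mul]

/-- **Finite volume of the typed prism** (transport of the tree's
`integrableOn_one_div_cube_idealTetrahedron`). -/
theorem integrableOn_Pc_simil (he : e ≠ 0) (hz : 0 < z.im) :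
    IntegrableOn (fun p : Fin 3 → ℝ => 1 / p 2 ^ 3) (Pc u (u + e) (u + e * z)) := by
  rw [← simil_image he]
  refine (integrableOn_image_iff_integrableOn_abs_det_fderiv_smul volume
    (measurableSet_idealTetrahedron z) (fun x _ => (hasFDerivAt_simil u e x).hasFDerivWithinAt)
    (simil_injective u he).injOn (fun p : Fin 3 → ℝ => 1 / p 2 ^ 3)).mpr ?_
  refine (integrableOn_one_div_cube_idealTetrahedron hz).congr_fun ?_ (measurableSet_idealTetrahedron z)
  intro x _
  exact (jacobian_cancel he x).symm

/-- **Volume of the typed prism** = volume of the standard ideal tetrahedron of the same shape. -/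
theorem integral_Pc_simil (he : e ≠ 0) :
    ∫ p in Pc u (u + e) (u + e * z), 1 / p 2 ^ 3 = idealTetrahedronVolume z := by
  rw [← simil_image he, integral_image_eq_integral_abs_det_fderiv_smul volume
    (measurableSet_idealTetrahedron z) (fun x _ => (hasFDerivAt_simil u e x).hasFDerivWithinAt)
    (simil_injective u he).injOn]
  unfold idealTetrahedronVolume
  refine setIntegral_congr_fun (measurableSet_idealTetrahedron z) ?_
  intro x _
  exact jacobian_cancel he x

/-- Shape parameter of the prism `(a, b, c)`: `z = (c − a)/(b − a)`; `Im z > 0 ⇔` counter-clockwise. -/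
theorem shape_im_pos {a b c : ℂ} (hccw : 0 < Lc a b (hat c)) : 0 < ((c - a) / (b - a)).im := by
  have he : b - a ≠ 0 := by
    intro h
    have hb : b = a := sub_eq_zero.mp h
    rw [hb] at hccw
    simp [Lc] at hccw
  have hn : 0 < Complex.normSq (b - a) := Complex.normSq_pos.mpr he
  rw [Complex.div_im, div_sub_div_same]
  refine div_pos ?_ hn
  have : (c - a).im * (b - a).re - (c - a).re * (b - a).im = Lc a b (hat c) := by
    simp [Lc]; ring
  rw [this]; exact hccw

theorem sub_ne_zero_of_ccw {a b c : ℂ} (hccw : 0 < Lc a b (hat c)) : b - a ≠ 0 := by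
  intro h
  have hb : b = a := sub_eq_zero.mp h
  rw [hb] at hccw
  simp [Lc] at hccw

theorem Pc_eq_Pc_simil {a b c : ℂ} (hccw : 0 < Lc a b (hat c)) :
    Pc a b c = Pc a (a + (b - a)) (a + (b - a) * ((c - a) / (b - a))) := by
  have he := sub_ne_zero_of_ccw hccw
  congr 1
  · ring
  · field_simp; ring

/-- Every counter-clockwise typed prism has finite hyperbolic volume. -/
theorem integrableOn_Pc {a b c : ℂ} (hccw : 0 < Lc a b (hat c)) :
    IntegrableOn (fun p : Fin 3 → ℝ => 1 / p 2 ^ 3) (Pc a b c) := by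
  rw [Pc_eq_Pc_simil hccw]
  exact integrableOn_Pc_simil (sub_ne_zero_of_ccw hccw) (shape_im_pos hccw)

/-- The hyperbolic volume of a counter-clockwise typed prism is that of the standard ideal
tetrahedron of shape `(c − a)/(b − a)`, in particular POSITIVE. -/
theorem integral_Pc {a b c : ℂ} (hccw : 0 < Lc a b (hat c)) :
    ∫ p in Pc a b c, 1 / p 2 ^ 3 = idealTetrahedronVolume ((c - a) / (b - a)) := by
  rw [Pc_eq_Pc_simil hccw, integral_Pc_simil (sub_ne_zero_of_ccw hccw)]

theorem integral_Pc_pos {a b c : ℂ} (hccw : 0 < Lc a b (hat c)) :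
    0 < ∫ p in Pc a b c, 1 / p 2 ^ 3 := by
  rw [integral_Pc hccw]; exact idealTetrahedronVolume_pos (shape_im_pos hccw)

/-! ### Semialgebraicity for algebraic vertices -/

/-- The cofactors of `S`. -/
def c₁ (u v w : ℂ) : ℝ := u.re * (v.im - w.im) - u.im * (v.re - w.re) + (v.re * w.im - v.im * w.re)
def c₂ (u v w : ℂ) : ℝ := Complex.normSq u * (v.im - w.im) - u.im * (Complex.normSq v - Complex.normSq w) + (Complex.normSq v * w.im - v.im * Complex.normSq w)
def c₃ (u v w : ℂ) : ℝ := Complex.normSq u * (v.re - w.re) - u.re * (Complex.normSq v - Complex.normSq w) + (Complex.normSq v * w.re - v.re * Complex.normSq w)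
def c₄ (u v w : ℂ) : ℝ := Complex.normSq u * (v.re * w.im - v.im * w.re) - u.re * (Complex.normSq v * w.im - v.im * Complex.normSq w) + u.im * (Complex.normSq v * w.re - v.re * Complex.normSq w)

theorem Sc_eq (u v w : ℂ) (p : Fin 3 → ℝ) :
    Sc u v w p = (p 0 ^ 2 + p 1 ^ 2 + p 2 ^ 2) * c₁ u v w - p 0 * c₂ u v w + p 1 * c₃ u v w - c₄ u v w :=
  rfl

theorem isAlgebraic_normSq {u : ℂ} (hu : IsAlgebraic ℚ u) : IsAlgebraic ℚ (Complex.normSq u) := by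
  obtain ⟨hr, hi⟩ := isAlgebraic_re_im hu
  rw [Complex.normSq_apply]; exact (hr.mul hr).add (hi.mul hi)

theorem isAlgebraic_c₁ {u v w : ℂ} (hu : IsAlgebraic ℚ u) (hv : IsAlgebraic ℚ v) (hw : IsAlgebraic ℚ w) :
    IsAlgebraic ℚ (c₁ u v w) := by
  obtain ⟨ur, ui⟩ := isAlgebraic_re_im hu
  obtain ⟨vr, vi⟩ := isAlgebraic_re_im hv
  obtain ⟨wr, wi⟩ := isAlgebraic_re_im hw
  exact ((ur.mul (vi.sub wi)).sub (ui.mul (vr.sub wr))).add ((vr.mul wi).sub (vi.mul wr))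

theorem isAlgebraic_c₂ {u v w : ℂ} (hu : IsAlgebraic ℚ u) (hv : IsAlgebraic ℚ v) (hw : IsAlgebraic ℚ w) :
    IsAlgebraic ℚ (c₂ u v w) := by
  obtain ⟨ur, ui⟩ := isAlgebraic_re_im hu
  obtain ⟨vr, vi⟩ := isAlgebraic_re_im hv
  obtain ⟨wr, wi⟩ := isAlgebraic_re_im hw
  have nu := isAlgebraic_normSq hu
  have nv := isAlgebraic_normSq hv
  have nw := isAlgebraic_normSq hw
  exact ((nu.mul (vi.sub wi)).sub (ui.mul (nv.sub nw))).add ((nv.mul wi).sub (vi.mul nw))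

theorem isAlgebraic_c₃ {u v w : ℂ} (hu : IsAlgebraic ℚ u) (hv : IsAlgebraic ℚ v) (hw : IsAlgebraic ℚ w) :
    IsAlgebraic ℚ (c₃ u v w) := by
  obtain ⟨ur, ui⟩ := isAlgebraic_re_im hu
  obtain ⟨vr, vi⟩ := isAlgebraic_re_im hv
  obtain ⟨wr, wi⟩ := isAlgebraic_re_im hw
  have nu := isAlgebraic_normSq hu
  have nv := isAlgebraic_normSq hv
  have nw := isAlgebraic_normSq hw
  exact ((nu.mul (vr.sub wr)).sub (ur.mul (nv.sub nw))).add ((nv.mul wr).sub (vr.mul nw))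

theorem isAlgebraic_c₄ {u v w : ℂ} (hu : IsAlgebraic ℚ u) (hv : IsAlgebraic ℚ v) (hw : IsAlgebraic ℚ w) :
    IsAlgebraic ℚ (c₄ u v w) := by
  obtain ⟨ur, ui⟩ := isAlgebraic_re_im hu
  obtain ⟨vr, vi⟩ := isAlgebraic_re_im hv
  obtain ⟨wr, wi⟩ := isAlgebraic_re_im hw
  have nu := isAlgebraic_normSq hu
  have nv := isAlgebraic_normSq hv
  have nw := isAlgebraic_normSq hw
  exact ((nu.mul ((vr.mul wi).sub (vi.mul wr))).sub (ur.mul ((nv.mul wi).sub (vi.mul nw)))).add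
    (ui.mul ((nv.mul wr).sub (vr.mul nw)))

/-- `Lc a b` is a `ℚ`-semialgebraic function on `ℝ³` for algebraic `a, b`. -/
theorem isSemialgebraicFunOn_Lc {a b : ℂ} (ha : IsAlgebraic ℚ a) (hb : IsAlgebraic ℚ b) :
    IsSemialgebraicFunOn ℚ (univ : Set (Fin 3 → ℝ)) (Lc a b) := by
  have hU : IsSemialgebraic ℚ (univ : Set (Fin 3 → ℝ)) := isSemialgebraic_univ
  have hc : ∀ i : Fin 3, IsSemialgebraicFunOn ℚ (univ : Set (Fin 3 → ℝ)) (fun p => p i) :=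
    fun i => (isSemialgebraicFunOn_aeval hU (X i)).congr fun p _ => by simp
  obtain ⟨ar, ai⟩ := isAlgebraic_re_im ha
  obtain ⟨br, bi⟩ := isAlgebraic_re_im hb
  have k1 : IsSemialgebraicFunOn ℚ (univ : Set (Fin 3 → ℝ)) (fun _ => b.re - a.re) :=
    isSemialgebraicFunOn_const_of_isAlgebraic hU (br.sub ar)
  have k2 : IsSemialgebraicFunOn ℚ (univ : Set (Fin 3 → ℝ)) (fun _ => b.im - a.im) :=
    isSemialgebraicFunOn_const_of_isAlgebraic hU (bi.sub ai)
  have k3 : IsSemialgebraicFunOn ℚ (univ : Set (Fin 3 → ℝ)) (fun _ => a.im) :=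
    isSemialgebraicFunOn_const_of_isAlgebraic hU ai
  have k4 : IsSemialgebraicFunOn ℚ (univ : Set (Fin 3 → ℝ)) (fun _ => a.re) :=
    isSemialgebraicFunOn_const_of_isAlgebraic hU ar
  exact (IsSemialgebraicFunOn.sub_holds
    (IsSemialgebraicFunOn.mul_holds k1 (IsSemialgebraicFunOn.sub_holds (hc 1) k3))
    (IsSemialgebraicFunOn.mul_holds k2 (IsSemialgebraicFunOn.sub_holds (hc 0) k4))).congr
    fun p _ => by simp [Lc]

/-- `Sc a b c` is a `ℚ`-semialgebraic function on `ℝ³` for algebraic `a, b, c`. -/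
theorem isSemialgebraicFunOn_Sc {a b c : ℂ} (ha : IsAlgebraic ℚ a) (hb : IsAlgebraic ℚ b)
    (hc' : IsAlgebraic ℚ c) : IsSemialgebraicFunOn ℚ (univ : Set (Fin 3 → ℝ)) (Sc a b c) := by
  have hU : IsSemialgebraic ℚ (univ : Set (Fin 3 → ℝ)) := isSemialgebraic_univ
  have hc : ∀ i : Fin 3, IsSemialgebraicFunOn ℚ (univ : Set (Fin 3 → ℝ)) (fun p => p i) :=
    fun i => (isSemialgebraicFunOn_aeval hU (X i)).congr fun p _ => by simp
  have hP : IsSemialgebraicFunOn ℚ (univ : Set (Fin 3 → ℝ)) (fun p => p 0 ^ 2 + p 1 ^ 2 + p 2 ^ 2) :=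
    (isSemialgebraicFunOn_aeval hU (X 0 ^ 2 + X 1 ^ 2 + X 2 ^ 2)).congr fun p _ => by simp
  have k1 : IsSemialgebraicFunOn ℚ (univ : Set (Fin 3 → ℝ)) (fun _ => c₁ a b c) :=
    isSemialgebraicFunOn_const_of_isAlgebraic hU (isAlgebraic_c₁ ha hb hc')
  have k2 : IsSemialgebraicFunOn ℚ (univ : Set (Fin 3 → ℝ)) (fun _ => c₂ a b c) :=
    isSemialgebraicFunOn_const_of_isAlgebraic hU (isAlgebraic_c₂ ha hb hc')
  have k3 : IsSemialgebraicFunOn ℚ (univ : Set (Fin 3 → ℝ)) (fun _ => c₃ a b c) :=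
    isSemialgebraicFunOn_const_of_isAlgebraic hU (isAlgebraic_c₃ ha hb hc')
  have k4 : IsSemialgebraicFunOn ℚ (univ : Set (Fin 3 → ℝ)) (fun _ => c₄ a b c) :=
    isSemialgebraicFunOn_const_of_isAlgebraic hU (isAlgebraic_c₄ ha hb hc')
  exact (IsSemialgebraicFunOn.sub_holds (IsSemialgebraicFunOn.add_holds (IsSemialgebraicFunOn.sub_holds
    (IsSemialgebraicFunOn.mul_holds hP k1) (IsSemialgebraicFunOn.mul_holds (hc 0) k2))
    (IsSemialgebraicFunOn.mul_holds (hc 1) k3)) k4).congr fun p _ => by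
      simp only [Pi.sub_apply, Pi.add_apply, Pi.mul_apply, Sc_eq]

theorem isSemialgebraicFunOn_zero3 : IsSemialgebraicFunOn ℚ (univ : Set (Fin 3 → ℝ)) (fun _ => (0 : ℝ)) := by
  simpa using isSemialgebraicFunOn_natCast (k := ℚ) (R := ℝ) isSemialgebraic_univ 0

theorem isSemialgebraicFunOn_coord (i : Fin 3) :
    IsSemialgebraicFunOn ℚ (univ : Set (Fin 3 → ℝ)) (fun p => p i) :=
  (isSemialgebraicFunOn_aeval isSemialgebraic_univ (X i)).congr fun p _ => by simp

/-- **The typed prism with algebraic vertices is `ℚ`-semialgebraic.** -/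
theorem isSemialgebraic_Pc {a b c : ℂ} (ha : IsAlgebraic ℚ a) (hb : IsAlgebraic ℚ b)
    (hc : IsAlgebraic ℚ c) : IsSemialgebraic ℚ (Pc a b c) := by
  have e : Pc a b c = {p : Fin 3 → ℝ | (0 : ℝ) < p 2} ∩ ({p | (0 : ℝ) < Lc a b p} ∩
      ({p | (0 : ℝ) < Lc b c p} ∩ ({p | (0 : ℝ) < Lc c a p} ∩ {p | (0 : ℝ) < Sc a b c p}))) := by
    ext p; simp [Pc]
  rw [e]
  refine (isSemialgebraic_setOf_lt_of_isSemialgebraicFunOn isSemialgebraicFunOn_zero3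
    (isSemialgebraicFunOn_coord 2)).inter ((isSemialgebraic_setOf_lt_of_isSemialgebraicFunOn
    isSemialgebraicFunOn_zero3 (isSemialgebraicFunOn_Lc ha hb)).inter
    ((isSemialgebraic_setOf_lt_of_isSemialgebraicFunOn isSemialgebraicFunOn_zero3
    (isSemialgebraicFunOn_Lc hb hc)).inter ((isSemialgebraic_setOf_lt_of_isSemialgebraicFunOn
    isSemialgebraicFunOn_zero3 (isSemialgebraicFunOn_Lc hc ha)).inter
    (isSemialgebraic_setOf_lt_of_isSemialgebraicFunOn isSemialgebraicFunOn_zero3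
    (isSemialgebraicFunOn_Sc ha hb hc)))))

/-- **The typed inner region with algebraic vertices is `ℚ`-semialgebraic.** -/
theorem isSemialgebraic_inner {a b c d : ℂ} (ha : IsAlgebraic ℚ a) (hb : IsAlgebraic ℚ b)
    (hc : IsAlgebraic ℚ c) (hd : IsAlgebraic ℚ d) :
    IsSemialgebraic ℚ {p : Fin 3 → ℝ | 0 < p 2 ∧ Sc a b c p < 0 ∧ 0 < Sc a b d p ∧ 0 < Sc b c d p ∧
      0 < Sc c a d p} := by
  have e : {p : Fin 3 → ℝ | 0 < p 2 ∧ Sc a b c p < 0 ∧ 0 < Sc a b d p ∧ 0 < Sc b c d p ∧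
      0 < Sc c a d p} = {p : Fin 3 → ℝ | (0 : ℝ) < p 2} ∩ ({p | Sc a b c p < (0 : ℝ)} ∩
      ({p | (0 : ℝ) < Sc a b d p} ∩ ({p | (0 : ℝ) < Sc b c d p} ∩ {p | (0 : ℝ) < Sc c a d p}))) := by
    ext p; simp
  rw [e]
  refine (isSemialgebraic_setOf_lt_of_isSemialgebraicFunOn isSemialgebraicFunOn_zero3
    (isSemialgebraicFunOn_coord 2)).inter ((isSemialgebraic_setOf_lt_of_isSemialgebraicFunOn
    (isSemialgebraicFunOn_Sc ha hb hc) isSemialgebraicFunOn_zero3).inter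
    ((isSemialgebraic_setOf_lt_of_isSemialgebraicFunOn isSemialgebraicFunOn_zero3
    (isSemialgebraicFunOn_Sc ha hb hd)).inter ((isSemialgebraic_setOf_lt_of_isSemialgebraicFunOn
    isSemialgebraicFunOn_zero3 (isSemialgebraicFunOn_Sc hb hc hd)).inter
    (isSemialgebraic_setOf_lt_of_isSemialgebraicFunOn isSemialgebraicFunOn_zero3
    (isSemialgebraicFunOn_Sc hc ha hd)))))

/-- A representation with integrand `t⁻³` on any `ℚ`-semialgebraic finite-volume region of the
upper half-space. -/
def mkRep (D : Set (Fin 3 → ℝ)) (hD : IsSemialgebraic ℚ D) (hpos : D ⊆ {p | 0 < p 2})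
    (hint : IntegrableOn (fun p : Fin 3 → ℝ => 1 / p 2 ^ 3) D) : KZ.IntegralRep 3 where
  domain := D
  integrand := fun p => 1 / p 2 ^ 3
  isSemialgebraic_domain := hD
  isSemialgebraicFunOn_integrand := isSemialgebraicFunOn_one_div_cube hD hpos
  integrableOn := hint

@[simp] theorem mkRep_domain (D : Set (Fin 3 → ℝ)) (hD hpos hint) : (mkRep D hD hpos hint).domain = D := rfl
@[simp] theorem mkRep_integrand (D : Set (Fin 3 → ℝ)) (hD hpos hint) :
    (mkRep D hD hpos hint).integrand = fun p => 1 / p 2 ^ 3 := rfl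

/-- **`prismRep`: the typed prism over a counter-clockwise triangle with algebraic vertices,
with integrand `t⁻³`, IS a Kontsevich–Zagier integral representation** (non-vacuity of the
crux's `rP, r₁, r₂, r₃`; first half of `IdealTetraRepExists`). -/
def prismRep (a b c : ℂ) (ha : IsAlgebraic ℚ a) (hb : IsAlgebraic ℚ b) (hc : IsAlgebraic ℚ c)
    (hccw : 0 < Lc a b (hat c)) : KZ.IntegralRep 3 :=
  mkRep (Pc a b c) (isSemialgebraic_Pc ha hb hc) (fun _ hp => hp.1) (integrableOn_Pc hccw)

@[simp] theorem prismRep_domain (a b c : ℂ) (ha hb hc hccw) :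
    (prismRep a b c ha hb hc hccw).domain = Pc a b c := rfl

@[simp] theorem prismRep_integrand (a b c : ℂ) (ha hb hc hccw) :
    (prismRep a b c ha hb hc hccw).integrand = fun p => 1 / p 2 ^ 3 := rfl

theorem prismRep_value_pos (a b c : ℂ) (ha hb hc hccw) :
    0 < (prismRep a b c ha hb hc hccw).value :=
  integral_Pc_pos hccw

theorem prismRep_isRational (a b c : ℂ) (ha hb hc hccw) : (prismRep a b c ha hb hc hccw).IsRational := by
  refine ⟨1, X 2 ^ 3, fun p hp => ?_, fun p _ => by simp⟩
  have h2 : (0 : ℝ) < p 2 := hp.1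
  simpa using pow_ne_zero 3 h2.ne'

end Prism

section Concrete2

/-- **The a.e. identity behind the crux holds** (all three interior hypotheses):
`prism(u,v,w) ∪ inner =ᵐ prism(u,v,q) ∪ prism(v,w,q) ∪ prism(w,u,q)`. -/
theorem aeIdentity_holds {u v w q : ℂ} (h1 : 0 < Lc u v (hat q)) (h2 : 0 < Lc v w (hat q))
    (h3 : 0 < Lc w u (hat q)) :
    (Pc u v w ∪ Ic u v w q : Set (Fin 3 → ℝ)) =ᵐ[volume] (Pc u v q ∪ Pc v w q ∪ Pc w u q : Set _) := by
  set Z : Set (Fin 3 → ℝ) := {p | Sc u v w p = 0 ∨ Lc u q p = 0 ∨ Lc v q p = 0 ∨ Lc w q p = 0}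
    with hZ_def
  have hZ : volume Z = 0 := volume_scaffold_eq_zero Lc_def Sc_def h1 h2 h3
  have hpt : ∀ p, p ∉ Z → ((p ∈ Pc u v w ∨ p ∈ Ic u v w q) ↔
      (p ∈ Pc u v q ∨ p ∈ Pc v w q ∨ p ∈ Pc w u q)) := by
    intro p hp
    simp only [hZ_def, mem_setOf_eq, not_or] at hp
    simp only [Pc, Ic, mem_setOf_eq]
    exact two_three_pointwise Lc_def Sc_def h1 h2 h3 hp.1 hp.2.1 hp.2.2.1 hp.2.2.2
  refine ae_eq_set.mpr ⟨measure_mono_null ?_ hZ, measure_mono_null ?_ hZ⟩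
  · intro p hp
    by_contra hz
    have := (hpt p hz).mp hp.1
    exact hp.2 (by simpa [mem_union, or_assoc] using this)
  · intro p hp
    by_contra hz
    have := (hpt p hz).mpr (by simpa [mem_union, or_assoc] using hp.1)
    exact hp.2 this

/-- NATURAL STRENGTHENING: the two unions of the 2–3 move are equal AS SETS (then the crux would be
two bare `domainAddRel` moves with literally equal unions). REFUTED below. -/
def ExactUnion : Prop :=
  ∀ (L : ℂ → ℂ → (Fin 3 → ℝ) → ℝ), (∀ u v p, L u v p = (v.re - u.re) * (p 1 - u.im) - (v.im - u.im) * (p 0 - u.re)) →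
  ∀ (S : ℂ → ℂ → ℂ → (Fin 3 → ℝ) → ℝ), (∀ u v w p, S u v w p = (p 0 ^ 2 + p 1 ^ 2 + p 2 ^ 2) * (u.re * (v.im - w.im) - u.im * (v.re - w.re) + (v.re * w.im - v.im * w.re)) - p 0 * (Complex.normSq u * (v.im - w.im) - u.im * (Complex.normSq v - Complex.normSq w) + (Complex.normSq v * w.im - v.im * Complex.normSq w)) + p 1 * (Complex.normSq u * (v.re - w.re) - u.re * (Complex.normSq v - Complex.normSq w) + (Complex.normSq v * w.re - v.re * Complex.normSq w)) - (Complex.normSq u * (v.re * w.im - v.im * w.re) - u.re * (Complex.normSq v * w.im - v.im * Complex.normSq w) + u.im * (Complex.normSq v * w.re - v.re * Complex.normSq w))) →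
  ∀ (P : ℂ → ℂ → ℂ → Set (Fin 3 → ℝ)),
    (∀ u v w, P u v w = {p | 0 < p 2 ∧ 0 < L u v p ∧ 0 < L v w p ∧ 0 < L w u p ∧ 0 < S u v w p}) →
  ∀ (u v w q : ℂ), IsAlgebraic ℚ u → IsAlgebraic ℚ v → IsAlgebraic ℚ w → IsAlgebraic ℚ q →
    0 < L u v ![q.re, q.im, 0] → 0 < L v w ![q.re, q.im, 0] → 0 < L w u ![q.re, q.im, 0] →
    P u v w ∪ {p | 0 < p 2 ∧ S u v w p < 0 ∧ 0 < S u v q p ∧ 0 < S v w q p ∧ 0 < S w u q p}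
      = P u v q ∪ P v w q ∪ P w u q

/-- **Refuted strengthening: the unions are NOT equal as sets.**  At `u, v, w, q = −5, 5, 5i, 2i`
the rational point `p = (12/5, 9/5, 4)` lies ON the big hemisphere `|p| = 5` over the open
triangle and off the spokes: it is in `prism(v,w,q)` but in neither `prism(u,v,w)` (`S = 0`, not
`> 0`) nor the inner tetrahedron (`S = 0`, not `< 0`).  So the crux is not two bare `domainAddRel`
moves; the null-set bookkeeping of §4 is necessary. -/
theorem not_exactUnion : ¬ ExactUnion := by
  intro h
  have key := h Lc Lc_def Sc Sc_def Pc Pc_def ⟨-5, 0⟩ ⟨5, 0⟩ ⟨0, 5⟩ ⟨0, 2⟩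
    (by simpa using isAlgebraic_mk_int (-5) 0) (by simpa using isAlgebraic_mk_int 5 0)
    (by simpa using isAlgebraic_mk_int 0 5) (by simpa using isAlgebraic_mk_int 0 2)
    (by norm_num) (by norm_num) (by norm_num)
  set p : Fin 3 → ℝ := ![12 / 5, 9 / 5, 4] with hp
  have h0 : p 0 = 12 / 5 := rfl
  have h1 : p 1 = 9 / 5 := rfl
  have h2 : p 2 = 4 := rfl
  have hmem : p ∈ Pc ⟨-5, 0⟩ ⟨5, 0⟩ ⟨0, 2⟩ ∪ Pc ⟨5, 0⟩ ⟨0, 5⟩ ⟨0, 2⟩ ∪ Pc ⟨0, 5⟩ ⟨-5, 0⟩ ⟨0, 2⟩ := by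
    refine Or.inl (Or.inr ?_)
    simp only [Pc, mem_setOf_eq, Lc_mk, Sc_mk, h0, h1, h2]
    norm_num
  rw [← key] at hmem
  rcases hmem with hmem | hmem
  · simp only [Pc, mem_setOf_eq, Lc_mk, Sc_mk, h0, h1, h2] at hmem
    norm_num at hmem
  · simp only [mem_setOf_eq, Sc_mk, h0, h1, h2] at hmem
    norm_num at hmem

/-- THE CRUX WITH THE FIRST INTERIOR HYPOTHESIS `0 < L u v q̂` DROPPED, at the level of the a.e. set
identity (the geometric content). REFUTED below: the hypothesis is load-bearing. -/
def AEIdentityWithoutInterior₁ : Prop :=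
  ∀ (L : ℂ → ℂ → (Fin 3 → ℝ) → ℝ), (∀ u v p, L u v p = (v.re - u.re) * (p 1 - u.im) - (v.im - u.im) * (p 0 - u.re)) →
  ∀ (S : ℂ → ℂ → ℂ → (Fin 3 → ℝ) → ℝ), (∀ u v w p, S u v w p = (p 0 ^ 2 + p 1 ^ 2 + p 2 ^ 2) * (u.re * (v.im - w.im) - u.im * (v.re - w.re) + (v.re * w.im - v.im * w.re)) - p 0 * (Complex.normSq u * (v.im - w.im) - u.im * (Complex.normSq v - Complex.normSq w) + (Complex.normSq v * w.im - v.im * Complex.normSq w)) + p 1 * (Complex.normSq u * (v.re - w.re) - u.re * (Complex.normSq v - Complex.normSq w) + (Complex.normSq v * w.re - v.re * Complex.normSq w)) - (Complex.normSq u * (v.re * w.im - v.im * w.re) - u.re * (Complex.normSq v * w.im - v.im * Complex.normSq w) + u.im * (Complex.normSq v * w.re - v.re * Complex.normSq w))) →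
  ∀ (P : ℂ → ℂ → ℂ → Set (Fin 3 → ℝ)),
    (∀ u v w, P u v w = {p | 0 < p 2 ∧ 0 < L u v p ∧ 0 < L v w p ∧ 0 < L w u p ∧ 0 < S u v w p}) →
  ∀ (u v w q : ℂ), IsAlgebraic ℚ u → IsAlgebraic ℚ v → IsAlgebraic ℚ w → IsAlgebraic ℚ q →
    0 < L v w ![q.re, q.im, 0] → 0 < L w u ![q.re, q.im, 0] →
    (P u v w ∪ {p | 0 < p 2 ∧ S u v w p < 0 ∧ 0 < S u v q p ∧ 0 < S v w q p ∧ 0 < S w u q p} :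
        Set (Fin 3 → ℝ))
      =ᵐ[volume] (P u v q ∪ P v w q ∪ P w u q : Set (Fin 3 → ℝ))

/-- **`0 < L u v q̂` is load-bearing (a.e. level).**  Configuration `C₂ = (−5, 5, 5i, −2i)`:
`q = −2i` lies below the edge `uv` (so `0 < L u v q̂` fails) but inside the circumcircle, and the
other two interior hypotheses hold.  Then `prism(u,v,q) = ∅` (clockwise triangle) and the box
`[1,2] × [−1/2,−1/4] × [10,20]` (positive volume) lies in `prism(v,w,q)` but neither in
`prism(u,v,w)` (`L u v < 0` there) nor in the inner region (`S u v w > 0` there): the two sides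
differ by the whole prism over the clockwise triangle `(u, v, q)`.  By the cyclic symmetry
`(u,v,w) ↦ (v,w,u)` of the statement each of the three interior hypotheses is load-bearing. -/
theorem not_aeIdentityWithoutInterior₁ : ¬ AEIdentityWithoutInterior₁ := by
  intro h
  have key := h Lc Lc_def Sc Sc_def Pc Pc_def ⟨-5, 0⟩ ⟨5, 0⟩ ⟨0, 5⟩ ⟨0, -2⟩
    (by simpa using isAlgebraic_mk_int (-5) 0) (by simpa using isAlgebraic_mk_int 5 0)
    (by simpa using isAlgebraic_mk_int 0 5) (by simpa using isAlgebraic_mk_int 0 (-2))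
    (by norm_num) (by norm_num)
  have hnull := (ae_eq_set.mp key).2
  set a : Fin 3 → ℝ := ![1, -1 / 2, 10] with ha
  set b : Fin 3 → ℝ := ![2, -1 / 4, 20] with hb
  have hbox : Icc a b ⊆ (Pc ⟨-5, 0⟩ ⟨5, 0⟩ ⟨0, -2⟩ ∪ Pc ⟨5, 0⟩ ⟨0, 5⟩ ⟨0, -2⟩ ∪
      Pc ⟨0, 5⟩ ⟨-5, 0⟩ ⟨0, -2⟩) \ (Pc ⟨-5, 0⟩ ⟨5, 0⟩ ⟨0, 5⟩ ∪ {p | 0 < p 2 ∧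
      Sc ⟨-5, 0⟩ ⟨5, 0⟩ ⟨0, 5⟩ p < 0 ∧ 0 < Sc ⟨-5, 0⟩ ⟨5, 0⟩ ⟨0, -2⟩ p ∧
      0 < Sc ⟨5, 0⟩ ⟨0, 5⟩ ⟨0, -2⟩ p ∧ 0 < Sc ⟨0, 5⟩ ⟨-5, 0⟩ ⟨0, -2⟩ p}) := by
    intro p hp
    rw [mem_Icc] at hp
    have hx1 : 1 ≤ p 0 := by simpa [ha] using hp.1 0
    have hx2 : p 0 ≤ 2 := by simpa [hb] using hp.2 0
    have hy1 : -1 / 2 ≤ p 1 := by simpa [ha] using hp.1 1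
    have hy2 : p 1 ≤ -1 / 4 := by simpa [hb] using hp.2 1
    have ht1 : 10 ≤ p 2 := by simpa [ha] using hp.1 2
    have ht2 : p 2 ≤ 20 := by simpa [hb] using hp.2 2
    constructor
    · refine Or.inl (Or.inr ?_)
      simp only [Pc, mem_setOf_eq, Lc_mk, Sc_mk]
      refine ⟨by linarith, by nlinarith, by nlinarith, by nlinarith, ?_⟩
      nlinarith [sq_nonneg (p 0), sq_nonneg (p 1), mul_le_mul ht1 ht1 (by norm_num) (by linarith)]
    · rintro (hp' | hp')
      · simp only [Pc, mem_setOf_eq, Lc_mk] at hp'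
        nlinarith [hp'.2.1]
      · simp only [mem_setOf_eq, Sc_mk] at hp'
        nlinarith [hp'.2.1, sq_nonneg (p 0), sq_nonneg (p 1),
          mul_le_mul ht1 ht1 (by norm_num) (by linarith)]
  have hvol : volume (Icc a b) = 0 := measure_mono_null hbox hnull
  rw [Real.volume_Icc_pi, Fin.prod_univ_three] at hvol
  simp [ha, hb] at hvol
  norm_num at hvol

/-! ### §5c KZ level: each interior hypothesis is load-bearing

Configuration `C₂ = (u, v, w, q) = (−5, 5, 5i, −2i)`: `q` across the edge `uv`, inside the
circumcircle.  Five honest KZ representations exist on the five typed domains (`prismRep`, the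
empty representation for the clockwise `prism(u,v,q) = ∅`, and `RI` on the inner region, which
is integrable because it lies a.e. inside `prism(v,w,q) ∪ prism(w,u,q)`), the CORRECT relation
`[RP] + [RI] + [RX] − [R2] − [R3] ∈ relations` holds (`RX` = prism over the re-oriented
`(u,q,v)`, §4b), and `[RX]` has positive value; so the typed combination is NOT a relation
(`C₂_not_mem`), and the crux with any one interior hypothesis deleted is FALSE. -/

/-- The vertices of configuration `C₂`. -/
def uC : ℂ := ⟨-5, 0⟩
def vC : ℂ := ⟨5, 0⟩
def wC : ℂ := ⟨0, 5⟩
def qC : ℂ := ⟨0, -2⟩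

theorem algU : IsAlgebraic ℚ uC := by simpa [uC] using isAlgebraic_mk_int (-5) 0
theorem algV : IsAlgebraic ℚ vC := by simpa [vC] using isAlgebraic_mk_int 5 0
theorem algW : IsAlgebraic ℚ wC := by simpa [wC] using isAlgebraic_mk_int 0 5
theorem algQ : IsAlgebraic ℚ qC := by simpa [qC] using isAlgebraic_mk_int 0 (-2)

theorem C₂_ccw : 0 < Lc uC vC (hat wC) := by norm_num [uC, vC, wC]
theorem C₂_α : 0 < Lc vC wC (hat qC) := by norm_num [vC, wC, qC]
theorem C₂_β : 0 < Lc wC uC (hat qC) := by norm_num [uC, wC, qC]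
theorem C₂_γ : Lc uC vC (hat qC) < 0 := by norm_num [uC, vC, qC]
theorem C₂_X : 0 < Lc uC qC (hat vC) := by norm_num [uC, vC, qC]
theorem C₂_K : Sc uC vC wC (hat qC) < 0 := by norm_num [uC, vC, wC, qC]
theorem C₂_A : 0 < Lc uC vC (hat qC) + Lc vC wC (hat qC) + Lc wC uC (hat qC) := by
  norm_num [uC, vC, wC, qC]

/-- The typed `prism(u, v, q)` of `C₂` is EMPTY (clockwise triangle). -/
theorem C₂_Pc_uvq_empty : Pc uC vC qC = ∅ := by
  ext p
  simp only [Pc, mem_setOf_eq, mem_empty_iff_false, iff_false, not_and, uC, vC, qC, Lc_mk]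
  intro _ h1 h2 h3
  nlinarith

/-- The four prism representations of `C₂`. -/
def RP : KZ.IntegralRep 3 := prismRep uC vC wC algU algV algW C₂_ccw
def R2 : KZ.IntegralRep 3 := prismRep vC wC qC algV algW algQ C₂_α
def R3 : KZ.IntegralRep 3 := prismRep wC uC qC algW algU algQ C₂_β
def RX : KZ.IntegralRep 3 := prismRep uC qC vC algU algQ algV C₂_X

/-- The typed inner region of `C₂` (the ideal tetrahedron `T(u, q, v, w)`). -/
def innerC : Set (Fin 3 → ℝ) :=
  {p | 0 < p 2 ∧ Sc uC vC wC p < 0 ∧ 0 < Sc uC vC qC p ∧ 0 < Sc vC wC qC p ∧ 0 < Sc wC uC qC p}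

/-- The inner region lies, off the null scaffold, inside `prism(v,w,q) ∪ prism(w,u,q)`; hence
`t⁻³` is integrable on it. -/
theorem integrableOn_innerC : IntegrableOn (fun p : Fin 3 → ℝ => 1 / p 2 ^ 3) innerC := by
  set Z : Set (Fin 3 → ℝ) :=
    {p | Sc uC vC wC p = 0 ∨ Lc uC vC p = 0 ∨ Sc uC vC qC p = 0 ∨ Lc wC qC p = 0} with hZ_def
  have hZ : volume Z = 0 := volume_scaffold_convex_eq_zero Lc_def Sc_def C₂_α C₂_K C₂_A
  have hsub : innerC ⊆ (Pc vC wC qC ∪ Pc wC uC qC) ∪ Z := by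
    intro p hp
    by_cases hz : p ∈ Z
    · exact Or.inr hz
    · left
      simp only [hZ_def, mem_setOf_eq, not_or] at hz
      simp only [innerC, mem_setOf_eq] at hp
      have := (two_three_pointwise_convex Lc_def Sc_def C₂_γ C₂_α C₂_β C₂_K C₂_A hz.1 hz.2.1
        hz.2.2.1 hz.2.2.2).mp (Or.inr (Or.inl hp))
      rcases this with h | h
      · exact Or.inl h
      · exact Or.inr h
  have hnull : IntegrableOn (fun p : Fin 3 → ℝ => 1 / p 2 ^ 3) Z := by
    rw [IntegrableOn, Measure.restrict_eq_zero.mpr hZ]; exact integrable_zero_measure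
  exact (((integrableOn_Pc C₂_α).union (integrableOn_Pc C₂_β)).union hnull).mono_set hsub

/-- The representation on the inner region of `C₂`. -/
def RI : KZ.IntegralRep 3 :=
  mkRep innerC (isSemialgebraic_inner algU algV algW algQ) (fun _ hp => hp.1) integrableOn_innerC

/-- The CORRECT relation at `C₂` (instance of §4b). -/
theorem C₂_true : KZ.of RP + KZ.of RI + KZ.of RX - KZ.of R2 - KZ.of R3 ∈ KZ.relations :=
  pachnerTwoThree_convex_general Lc_def Sc_def C₂_γ C₂_α C₂_β C₂_K C₂_A (fun p => 1 / p 2 ^ 3)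
    RP RI RX R2 R3 rfl rfl rfl rfl rfl (fun _ _ => rfl) (fun _ _ => rfl) (fun _ _ => rfl)
    (fun _ _ => rfl) (fun _ _ => rfl)

/-- **The typed combination at `C₂` is NOT a KZ relation**: it differs from the correct relation
by `[RX] + [∅]`, and `[RX]` has positive value (volume of the ideal tetrahedron `(∞, u, q, v)`)
while relations evaluate to `0` (soundness of the calculus). -/
theorem C₂_not_mem :
    KZ.of RP + KZ.of RI - KZ.of (KZ.IntegralRep.empty 3) - KZ.of R2 - KZ.of R3 ∉ KZ.relations := by
  intro hmem
  have hE : KZ.of (KZ.IntegralRep.empty 3) ∈ KZ.relations := KZ.IntegralRep.of_empty_mem_relations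
  have hX : KZ.of RX ∈ KZ.relations := by
    have e : KZ.of RX = (KZ.of RP + KZ.of RI + KZ.of RX - KZ.of R2 - KZ.of R3) -
        (KZ.of RP + KZ.of RI - KZ.of (KZ.IntegralRep.empty 3) - KZ.of R2 - KZ.of R3) -
        KZ.of (KZ.IntegralRep.empty 3) := by abel
    rw [e]
    exact KZ.relations.sub_mem (KZ.relations.sub_mem C₂_true hmem) hE
  have h0 := KZ.relations_le_ker_eval_holds hX
  rw [AddMonoidHom.mem_ker, KZ.eval_of] at h0
  have hpos : 0 < RX.value := prismRep_value_pos uC qC vC algU algQ algV C₂_X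
  linarith

/-- THE CRUX WITH THE FIRST INTERIOR HYPOTHESIS `0 < L u v q̂` DELETED (everything else verbatim). -/
def PachnerTwoThreeWithoutInterior₁ : Prop :=
  ∀ (L : ℂ → ℂ → (Fin 3 → ℝ) → ℝ), (∀ u v p, L u v p = (v.re - u.re) * (p 1 - u.im) - (v.im - u.im) * (p 0 - u.re)) →
  ∀ (S : ℂ → ℂ → ℂ → (Fin 3 → ℝ) → ℝ), (∀ u v w p, S u v w p = (p 0 ^ 2 + p 1 ^ 2 + p 2 ^ 2) * (u.re * (v.im - w.im) - u.im * (v.re - w.re) + (v.re * w.im - v.im * w.re)) - p 0 * (Complex.normSq u * (v.im - w.im) - u.im * (Complex.normSq v - Complex.normSq w) + (Complex.normSq v * w.im - v.im * Complex.normSq w)) + p 1 * (Complex.normSq u * (v.re - w.re) - u.re * (Complex.normSq v - Complex.normSq w) + (Complex.normSq v * w.re - v.re * Complex.normSq w)) - (Complex.normSq u * (v.re * w.im - v.im * w.re) - u.re * (Complex.normSq v * w.im - v.im * Complex.normSq w) + u.im * (Complex.normSq v * w.re - v.re * Complex.normSq w))) →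
  ∀ (P : ℂ → ℂ → ℂ → Set (Fin 3 → ℝ)),
    (∀ u v w, P u v w = {p | 0 < p 2 ∧ 0 < L u v p ∧ 0 < L v w p ∧ 0 < L w u p ∧ 0 < S u v w p}) →
  ∀ (u v w q : ℂ), IsAlgebraic ℚ u → IsAlgebraic ℚ v → IsAlgebraic ℚ w → IsAlgebraic ℚ q →
    0 < L v w ![q.re, q.im, 0] → 0 < L w u ![q.re, q.im, 0] →
  ∀ (rP rI r₁ r₂ r₃ : KZ.IntegralRep 3),
    rP.domain = P u v w →
    rI.domain = {p | 0 < p 2 ∧ S u v w p < 0 ∧ 0 < S u v q p ∧ 0 < S v w q p ∧ 0 < S w u q p} →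
    r₁.domain = P u v q → r₂.domain = P v w q → r₃.domain = P w u q →
    Set.EqOn rP.integrand (fun p => 1 / p 2 ^ 3) rP.domain →
    Set.EqOn rI.integrand (fun p => 1 / p 2 ^ 3) rI.domain →
    Set.EqOn r₁.integrand (fun p => 1 / p 2 ^ 3) r₁.domain →
    Set.EqOn r₂.integrand (fun p => 1 / p 2 ^ 3) r₂.domain →
    Set.EqOn r₃.integrand (fun p => 1 / p 2 ^ 3) r₃.domain →
    KZ.of rP + KZ.of rI - KZ.of r₁ - KZ.of r₂ - KZ.of r₃ ∈ KZ.relations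

/-- THE CRUX WITH THE SECOND INTERIOR HYPOTHESIS `0 < L v w q̂` DELETED. -/
def PachnerTwoThreeWithoutInterior₂ : Prop :=
  ∀ (L : ℂ → ℂ → (Fin 3 → ℝ) → ℝ), (∀ u v p, L u v p = (v.re - u.re) * (p 1 - u.im) - (v.im - u.im) * (p 0 - u.re)) →
  ∀ (S : ℂ → ℂ → ℂ → (Fin 3 → ℝ) → ℝ), (∀ u v w p, S u v w p = (p 0 ^ 2 + p 1 ^ 2 + p 2 ^ 2) * (u.re * (v.im - w.im) - u.im * (v.re - w.re) + (v.re * w.im - v.im * w.re)) - p 0 * (Complex.normSq u * (v.im - w.im) - u.im * (Complex.normSq v - Complex.normSq w) + (Complex.normSq v * w.im - v.im * Complex.normSq w)) + p 1 * (Complex.normSq u * (v.re - w.re) - u.re * (Complex.normSq v - Complex.normSq w) + (Complex.normSq v * w.re - v.re * Complex.normSq w)) - (Complex.normSq u * (v.re * w.im - v.im * w.re) - u.re * (Complex.normSq v * w.im - v.im * Complex.normSq w) + u.im * (Complex.normSq v * w.re - v.re * Complex.normSq w))) →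
  ∀ (P : ℂ → ℂ → ℂ → Set (Fin 3 → ℝ)),
    (∀ u v w, P u v w = {p | 0 < p 2 ∧ 0 < L u v p ∧ 0 < L v w p ∧ 0 < L w u p ∧ 0 < S u v w p}) →
  ∀ (u v w q : ℂ), IsAlgebraic ℚ u → IsAlgebraic ℚ v → IsAlgebraic ℚ w → IsAlgebraic ℚ q →
    0 < L u v ![q.re, q.im, 0] → 0 < L w u ![q.re, q.im, 0] →
  ∀ (rP rI r₁ r₂ r₃ : KZ.IntegralRep 3),
    rP.domain = P u v w →
    rI.domain = {p | 0 < p 2 ∧ S u v w p < 0 ∧ 0 < S u v q p ∧ 0 < S v w q p ∧ 0 < S w u q p} →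
    r₁.domain = P u v q → r₂.domain = P v w q → r₃.domain = P w u q →
    Set.EqOn rP.integrand (fun p => 1 / p 2 ^ 3) rP.domain →
    Set.EqOn rI.integrand (fun p => 1 / p 2 ^ 3) rI.domain →
    Set.EqOn r₁.integrand (fun p => 1 / p 2 ^ 3) r₁.domain →
    Set.EqOn r₂.integrand (fun p => 1 / p 2 ^ 3) r₂.domain →
    Set.EqOn r₃.integrand (fun p => 1 / p 2 ^ 3) r₃.domain →
    KZ.of rP + KZ.of rI - KZ.of r₁ - KZ.of r₂ - KZ.of r₃ ∈ KZ.relations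

/-- THE CRUX WITH THE THIRD INTERIOR HYPOTHESIS `0 < L w u q̂` DELETED. -/
def PachnerTwoThreeWithoutInterior₃ : Prop :=
  ∀ (L : ℂ → ℂ → (Fin 3 → ℝ) → ℝ), (∀ u v p, L u v p = (v.re - u.re) * (p 1 - u.im) - (v.im - u.im) * (p 0 - u.re)) →
  ∀ (S : ℂ → ℂ → ℂ → (Fin 3 → ℝ) → ℝ), (∀ u v w p, S u v w p = (p 0 ^ 2 + p 1 ^ 2 + p 2 ^ 2) * (u.re * (v.im - w.im) - u.im * (v.re - w.re) + (v.re * w.im - v.im * w.re)) - p 0 * (Complex.normSq u * (v.im - w.im) - u.im * (Complex.normSq v - Complex.normSq w) + (Complex.normSq v * w.im - v.im * Complex.normSq w)) + p 1 * (Complex.normSq u * (v.re - w.re) - u.re * (Complex.normSq v - Complex.normSq w) + (Complex.normSq v * w.re - v.re * Complex.normSq w)) - (Complex.normSq u * (v.re * w.im - v.im * w.re) - u.re * (Complex.normSq v * w.im - v.im * Complex.normSq w) + u.im * (Complex.normSq v * w.re - v.re * Complex.normSq w))) →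
  ∀ (P : ℂ → ℂ → ℂ → Set (Fin 3 → ℝ)),
    (∀ u v w, P u v w = {p | 0 < p 2 ∧ 0 < L u v p ∧ 0 < L v w p ∧ 0 < L w u p ∧ 0 < S u v w p}) →
  ∀ (u v w q : ℂ), IsAlgebraic ℚ u → IsAlgebraic ℚ v → IsAlgebraic ℚ w → IsAlgebraic ℚ q →
    0 < L u v ![q.re, q.im, 0] → 0 < L v w ![q.re, q.im, 0] →
  ∀ (rP rI r₁ r₂ r₃ : KZ.IntegralRep 3),
    rP.domain = P u v w →
    rI.domain = {p | 0 < p 2 ∧ S u v w p < 0 ∧ 0 < S u v q p ∧ 0 < S v w q p ∧ 0 < S w u q p} →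
    r₁.domain = P u v q → r₂.domain = P v w q → r₃.domain = P w u q →
    Set.EqOn rP.integrand (fun p => 1 / p 2 ^ 3) rP.domain →
    Set.EqOn rI.integrand (fun p => 1 / p 2 ^ 3) rI.domain →
    Set.EqOn r₁.integrand (fun p => 1 / p 2 ^ 3) r₁.domain →
    Set.EqOn r₂.integrand (fun p => 1 / p 2 ^ 3) r₂.domain →
    Set.EqOn r₃.integrand (fun p => 1 / p 2 ^ 3) r₃.domain →
    KZ.of rP + KZ.of rI - KZ.of r₁ - KZ.of r₂ - KZ.of r₃ ∈ KZ.relations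

/-- The inner set of `C₂` relabelled `(u,v,w) ↦ (w,u,v)`. -/
theorem innerC_eq₂ : innerC = {p : Fin 3 → ℝ | 0 < p 2 ∧ Sc wC uC vC p < 0 ∧ 0 < Sc wC uC qC p ∧
    0 < Sc uC vC qC p ∧ 0 < Sc vC wC qC p} := by
  ext p
  have e : Sc wC uC vC p = Sc uC vC wC p := by
    rw [S_cyclic Sc_def vC wC uC p, S_cyclic Sc_def uC vC wC p]
  simp only [innerC, mem_setOf_eq, e]
  tauto

/-- The inner set of `C₂` relabelled `(u,v,w) ↦ (v,w,u)`. -/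
theorem innerC_eq₃ : innerC = {p : Fin 3 → ℝ | 0 < p 2 ∧ Sc vC wC uC p < 0 ∧ 0 < Sc vC wC qC p ∧
    0 < Sc wC uC qC p ∧ 0 < Sc uC vC qC p} := by
  ext p
  have e : Sc vC wC uC p = Sc uC vC wC p := S_cyclic Sc_def uC vC wC p
  simp only [innerC, mem_setOf_eq, e]
  tauto

/-- **`0 < L u v q̂` is load-bearing at the KZ level**: the crux with it deleted is FALSE
(witness `C₂`, reps `RP, RI, ∅, R2, R3`; `C₂_not_mem`). Any proof of the crux must use it. -/
theorem pachnerTwoThree_false_without_interior₁ : ¬ PachnerTwoThreeWithoutInterior₁ := by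
  intro h
  exact C₂_not_mem (h Lc Lc_def Sc Sc_def Pc Pc_def uC vC wC qC algU algV algW algQ C₂_α C₂_β
    RP RI (KZ.IntegralRep.empty 3) R2 R3 rfl rfl (by simp [C₂_Pc_uvq_empty]) rfl rfl
    (fun _ _ => rfl) (fun _ _ => rfl) (fun _ h => h.elim) (fun _ _ => rfl) (fun _ _ => rfl))

/-- **`0 < L v w q̂` is load-bearing at the KZ level** (witness: `C₂` relabelled
`(u,v,w) ↦ (w,u,v) = (5i, −5, 5, −2i)`). -/
theorem pachnerTwoThree_false_without_interior₂ : ¬ PachnerTwoThreeWithoutInterior₂ := by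
  intro h
  have hdom : RP.domain = Pc wC uC vC := ((Pc_cyclic vC wC uC).trans (Pc_cyclic uC vC wC)).symm
  have := h Lc Lc_def Sc Sc_def Pc Pc_def wC uC vC qC algW algU algV algQ C₂_β C₂_α
    RP RI R3 (KZ.IntegralRep.empty 3) R2 hdom innerC_eq₂ rfl (by simp [C₂_Pc_uvq_empty]) rfl
    (fun _ _ => rfl) (fun _ _ => rfl) (fun _ _ => rfl) (fun _ h => h.elim) (fun _ _ => rfl)
  have e : KZ.of RP + KZ.of RI - KZ.of R3 - KZ.of (KZ.IntegralRep.empty 3) - KZ.of R2 =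
      KZ.of RP + KZ.of RI - KZ.of (KZ.IntegralRep.empty 3) - KZ.of R2 - KZ.of R3 := by abel
  rw [e] at this
  exact C₂_not_mem this

/-- **`0 < L w u q̂` is load-bearing at the KZ level** (witness: `C₂` relabelled
`(u,v,w) ↦ (v,w,u) = (5, 5i, −5, −2i)`). -/
theorem pachnerTwoThree_false_without_interior₃ : ¬ PachnerTwoThreeWithoutInterior₃ := by
  intro h
  have hdom : RP.domain = Pc vC wC uC := (Pc_cyclic uC vC wC).symm
  have := h Lc Lc_def Sc Sc_def Pc Pc_def vC wC uC qC algV algW algU algQ C₂_α C₂_β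
    RP RI R2 R3 (KZ.IntegralRep.empty 3) hdom innerC_eq₃ rfl rfl (by simp [C₂_Pc_uvq_empty])
    (fun _ _ => rfl) (fun _ _ => rfl) (fun _ _ => rfl) (fun _ _ => rfl) (fun _ h => h.elim)
  have e : KZ.of RP + KZ.of RI - KZ.of R2 - KZ.of R3 - KZ.of (KZ.IntegralRep.empty 3) =
      KZ.of RP + KZ.of RI - KZ.of (KZ.IntegralRep.empty 3) - KZ.of R2 - KZ.of R3 := by abel
  rw [e] at this
  exact C₂_not_mem this

end Concrete2

/-- **THE CRUX IS TRUE.**  `HyperbolicBloch.PachnerTwoThree` (stmt-KontsevichZagierPeriods-3470),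
sorry-free, from `pachnerTwoThree_general` with `f = t⁻³`; the `IsAlgebraic` hypotheses and the
`P`-abbreviation are discharged syntactically.  (A refuter cannot land this in `Theorems/`; a
prover may copy it verbatim: target `Theorems/HyperbolicBlochPachnerTwoThree.lean`,
`--workitem stmt-KontsevichZagierPeriods-3470`.) -/
theorem pachnerTwoThree_holds :
    Summit.KontsevichZagierPeriods.KontsevichZagierPeriods.Theses.HyperbolicBloch.PachnerTwoThree := by
  intro L hL S hS P hP u v w q _ _ _ _ h1 h2 h3 rP rI r₁ r₂ r₃ dP dI d₁ d₂ d₃ fP fI f₁ f₂ f₃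
  rw [hP] at dP d₁ d₂ d₃
  exact pachnerTwoThree_general hL hS h1 h2 h3 (fun p => 1 / p 2 ^ 3) rP rI r₁ r₂ r₃ dP dI d₁ d₂ d₃
    fP fI f₁ f₂ f₃


/-! ## §6 By-product: the support item `IdealTetraRepExists` (stmt-KontsevichZagierPeriods-3473)

Both representations asked for by `IdealTetraRepExists` exist: the prism is `prismRep` (§5b) and
the inner tetrahedron is integrable because, off the null scaffold, it lies inside the three small
prisms (§2).  A prover may land `idealTetraRepExists_holds` (Theorems, `--workitem stmt-…-3473`). -/
section ByProduct

/-- The inner tetrahedron `(q; u, v, w)` over a ccw triangle with `q̂` strictly inside carries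
`t⁻³` integrably: it lies a.e. inside `prism(u,v,q) ∪ prism(v,w,q) ∪ prism(w,u,q)`. -/
theorem integrableOn_inner {u v w q : ℂ} (h1 : 0 < Lc u v (hat q)) (h2 : 0 < Lc v w (hat q))
    (h3 : 0 < Lc w u (hat q)) :
    IntegrableOn (fun p : Fin 3 → ℝ => 1 / p 2 ^ 3) (Ic u v w q) := by
  set Z : Set (Fin 3 → ℝ) := {p | Sc u v w p = 0 ∨ Lc u q p = 0 ∨ Lc v q p = 0 ∨ Lc w q p = 0}
    with hZ_def
  have hZ : volume Z = 0 := volume_scaffold_eq_zero Lc_def Sc_def h1 h2 h3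
  have hsub : Ic u v w q ⊆ (Pc u v q ∪ Pc v w q ∪ Pc w u q) ∪ Z := by
    intro p hp
    by_cases hz : p ∈ Z
    · exact Or.inr hz
    · left
      simp only [hZ_def, mem_setOf_eq, not_or] at hz
      simp only [Ic, mem_setOf_eq] at hp
      have := (two_three_pointwise Lc_def Sc_def h1 h2 h3 hz.1 hz.2.1 hz.2.2.1 hz.2.2.2).mp
        (Or.inr hp)
      rcases this with h | h | h
      · exact Or.inl (Or.inl h)
      · exact Or.inl (Or.inr h)
      · exact Or.inr h
  have hnull : IntegrableOn (fun p : Fin 3 → ℝ => 1 / p 2 ^ 3) Z := by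
    rw [IntegrableOn, Measure.restrict_eq_zero.mpr hZ]; exact integrable_zero_measure
  exact ((((integrableOn_Pc h1).union (integrableOn_Pc h2)).union (integrableOn_Pc h3)).union
    hnull).mono_set hsub

/-- **`innerRep`: the typed inner tetrahedron with algebraic vertices, integrand `t⁻³`, is a KZ
integral representation** (non-vacuity of the crux's `rI`). -/
def innerRep (u v w q : ℂ) (hu : IsAlgebraic ℚ u) (hv : IsAlgebraic ℚ v) (hw : IsAlgebraic ℚ w)
    (hq : IsAlgebraic ℚ q) (h1 : 0 < Lc u v (hat q)) (h2 : 0 < Lc v w (hat q))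
    (h3 : 0 < Lc w u (hat q)) : KZ.IntegralRep 3 :=
  mkRep (Ic u v w q) (isSemialgebraic_inner hu hv hw hq) (fun _ hp => hp.1) (integrableOn_inner h1 h2 h3)

theorem mkRep_isRational (D : Set (Fin 3 → ℝ)) (hD hpos hint) : (mkRep D hD hpos hint).IsRational := by
  refine ⟨1, X 2 ^ 3, fun p hp => ?_, fun p _ => by simp⟩
  have h2 : (0 : ℝ) < p 2 := hpos hp
  simpa using pow_ne_zero 3 h2.ne'

/-- **The support item `IdealTetraRepExists` HOLDS** (by-product; a prover may land it). -/
theorem idealTetraRepExists_holds :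
    Summit.KontsevichZagierPeriods.KontsevichZagierPeriods.Theses.HyperbolicBloch.IdealTetraRepExists := by
  intro L hL S hS u v w q hu hv hw hq hccw
  have eL : L = Lc := by
    funext a b p; rw [hL]; rfl
  have eS : S = Sc := by
    funext a b c p; rw [hS]; rfl
  subst eL eS
  refine ⟨⟨prismRep u v w hu hv hw hccw, rfl, fun _ _ => rfl, mkRep_isRational _ _ _ _⟩, ?_⟩
  intro h1 h2 h3
  exact ⟨innerRep u v w q hu hv hw hq h1 h2 h3, rfl, fun _ _ => rfl, mkRep_isRational _ _ _ _⟩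

end ByProduct

/-! ## §7 Boundary of the truth region: `q̂` ON an edge or AT a vertex — still TRUE (g3)

The three interior hypotheses `0 < L u v q̂, 0 < L v w q̂, 0 < L w u q̂` can be weakened
SIMULTANEOUSLY to `0 ≤ …` (closed triangle; the non-degeneracy `0 < L u v ŵ`, automatic in the
crux, made explicit): `pachnerTwoThreeClosed_holds`.  On an open edge (`γ = 0 < α, β`) the typed
`prism(u,v,q)` is EMPTY and the move degenerates to the 2–2 move on the pyramid over the flat
ideal quadrilateral `(∞, u, q, v)` (`core_edge`, `two_three_pointwise_edge`, scaffold
`{S u v w = 0} ∪ {L w q = 0}`); at a vertex (`q = u`, `eq_vertex`) the inner region and two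
prisms are empty and `prism(v,w,q) = prism(u,v,w)`.  With §5c (strictly across an edge: refuted)
this pins the boundary of validity of the typed statement exactly at the edges. -/
section Edge

/-- **Abstract core, edge configuration** (`γ = 0 < α, β`, `K > 0`): the typed `prism(u,v,q)`
is empty and the 2–3 move degenerates to the 2–2 move
`prism(u,v,w) ∪ inner = prism(v,w,q) ∪ prism(w,u,q)` off `{σ = 0} ∪ {Lwq = 0}`. -/
theorem core_edge {α β γ K A a b c σ Luq Lqu Lvq Lqv Lwq Lqw Suvq Svwq Swuq : ℝ}
    (hα : 0 < α) (hβ : 0 < β) (hγ : γ = 0) (hK : 0 < K) (hA : 0 < A)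
    (euq : A * Luq = β * c - γ * b) (equ : A * Lqu = γ * b - β * c)
    (evq : A * Lvq = γ * a - α * c) (eqv : A * Lqv = α * c - γ * a)
    (ewq : A * Lwq = α * b - β * a) (eqw : A * Lqw = β * a - α * b)
    (e₁ : A * Suvq = γ * σ + K * c) (e₂ : A * Svwq = α * σ + K * a)
    (e₃ : A * Swuq = β * σ + K * b)
    (hσ : σ ≠ 0) (hw : Lwq ≠ 0) :
    ((0 < c ∧ 0 < a ∧ 0 < b ∧ 0 < σ) ∨ (σ < 0 ∧ 0 < Suvq ∧ 0 < Svwq ∧ 0 < Swuq)) ↔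
    ((0 < c ∧ 0 < Lvq ∧ 0 < Lqu ∧ 0 < Suvq) ∨ (0 < a ∧ 0 < Lwq ∧ 0 < Lqv ∧ 0 < Svwq) ∨
      (0 < b ∧ 0 < Luq ∧ 0 < Lqw ∧ 0 < Swuq)) := by
  subst hγ
  simp only [zero_mul, zero_sub, sub_zero, zero_add] at euq equ evq eqv e₁
  have t : ∀ {X Y : ℝ}, A * X = Y → (0 < X ↔ 0 < Y) := fun e => by
    rw [← e, mul_pos_iff_of_pos_left hA]
  have h₃ : α * b - β * a ≠ 0 := by rw [← ewq]; exact mul_ne_zero hA.ne' hw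
  rw [t euq, t equ, t evq, t eqv, t ewq, t eqw, t e₁, t e₂, t e₃]
  constructor
  · rintro (⟨hc, ha, hb, hs⟩ | ⟨hs, k1, k2, k3⟩)
    · rcases lt_or_gt_of_ne h₃ with k | k
      · exact Or.inr (Or.inr ⟨hb, mul_pos hβ hc, by linarith,
          add_pos (mul_pos hβ hs) (mul_pos hK hb)⟩)
      · exact Or.inr (Or.inl ⟨ha, k, mul_pos hα hc, add_pos (mul_pos hα hs) (mul_pos hK ha)⟩)
    · have hc : 0 < c := pos_of_mul_pos_right k1 hK.le
      have hασ : α * σ < 0 := mul_neg_of_pos_of_neg hα hs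
      have hβσ : β * σ < 0 := mul_neg_of_pos_of_neg hβ hs
      have ha : 0 < a := pos_of_mul_pos_right (by linarith) hK.le
      have hb : 0 < b := pos_of_mul_pos_right (by linarith) hK.le
      rcases lt_or_gt_of_ne h₃ with k | k
      · exact Or.inr (Or.inr ⟨hb, mul_pos hβ hc, by linarith, k3⟩)
      · exact Or.inr (Or.inl ⟨ha, k, mul_pos hα hc, k2⟩)
  · rintro (⟨hc, h2, -, -⟩ | ⟨ha, h3, h2, hs⟩ | ⟨hb, h1, h3, hs⟩)
    · exfalso
      have : 0 < α * c := mul_pos hα hc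
      linarith
    · have hc : 0 < c := pos_of_mul_pos_right h2 hα.le
      have hb : 0 < b := by
        have : 0 < α * b := by linarith [mul_pos hβ ha]
        exact pos_of_mul_pos_right this hα.le
      rcases lt_or_gt_of_ne hσ with k | k
      · refine Or.inr ⟨k, mul_pos hK hc, hs, ?_⟩
        have e : α * (β * σ + K * b) = β * (α * σ + K * a) + K * (α * b - β * a) := by ring
        have : 0 < α * (β * σ + K * b) := by rw [e]; exact add_pos (mul_pos hβ hs) (mul_pos hK h3)
        exact pos_of_mul_pos_right this hα.le
      · exact Or.inl ⟨hc, ha, hb, k⟩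
    · have hc : 0 < c := pos_of_mul_pos_right h1 hβ.le
      have ha : 0 < a := by
        have : 0 < β * a := by linarith [mul_pos hα hb]
        exact pos_of_mul_pos_right this hβ.le
      rcases lt_or_gt_of_ne hσ with k | k
      · refine Or.inr ⟨k, mul_pos hK hc, ?_, hs⟩
        have e : β * (α * σ + K * a) = α * (β * σ + K * b) + K * (β * a - α * b) := by ring
        have : 0 < β * (α * σ + K * a) := by rw [e]; exact add_pos (mul_pos hα hs) (mul_pos hK h3)
        exact pos_of_mul_pos_right this hβ.le
      · exact Or.inl ⟨hc, ha, hb, k⟩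

variable {L : ℂ → ℂ → (Fin 3 → ℝ) → ℝ} {S : ℂ → ℂ → ℂ → (Fin 3 → ℝ) → ℝ}
variable (hL : ∀ u v p, L u v p = (v.re - u.re) * (p 1 - u.im) - (v.im - u.im) * (p 0 - u.re))
  (hS : ∀ u v w p, S u v w p = (p 0 ^ 2 + p 1 ^ 2 + p 2 ^ 2) * (u.re * (v.im - w.im) - u.im * (v.re - w.re) + (v.re * w.im - v.im * w.re)) - p 0 * (Complex.normSq u * (v.im - w.im) - u.im * (Complex.normSq v - Complex.normSq w) + (Complex.normSq v * w.im - v.im * Complex.normSq w)) + p 1 * (Complex.normSq u * (v.re - w.re) - u.re * (Complex.normSq v - Complex.normSq w) + (Complex.normSq v * w.re - v.re * Complex.normSq w)) - (Complex.normSq u * (v.re * w.im - v.im * w.re) - u.re * (Complex.normSq v * w.im - v.im * Complex.normSq w) + u.im * (Complex.normSq v * w.re - v.re * Complex.normSq w)))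

include hL in
/-- On the open edge `uv` the endpoints are distinct: `|u − v|² > 0`. -/
theorem dist_sq_pos_of_edge {u v w q : ℂ} (hα : 0 < L v w (hat q)) (hβ : 0 < L w u (hat q)) :
    0 < (u.re - v.re) ^ 2 + (u.im - v.im) ^ 2 := by
  by_contra hle
  push Not at hle
  have e1 : u.re - v.re = 0 := by nlinarith [sq_nonneg (u.re - v.re), sq_nonneg (u.im - v.im)]
  have e2 : u.im - v.im = 0 := by nlinarith [sq_nonneg (u.re - v.re), sq_nonneg (u.im - v.im)]
  have : L v w (hat q) = -L w u (hat q) := by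
    simp only [hL, hat_zero, hat_one]
    have h1' : v.re = u.re := by linarith
    have h2' : v.im = u.im := by linarith
    rw [h1', h2']; ring
  linarith

include hL hS in
/-- Edge power identity: with `γ = 0`, `(α + β) · S u v w q̂ = −|u − v|² · α β`. -/
theorem power_hat_edge {u v w q : ℂ} (hγ : L u v (hat q) = 0) :
    (L v w (hat q) + L w u (hat q)) * S u v w (hat q)
      = -(((u.re - v.re) ^ 2 + (u.im - v.im) ^ 2) * L v w (hat q) * L w u (hat q)) := by
  linear_combination (power_hat hL hS u v w q)
    - (((v.re - w.re) ^ 2 + (v.im - w.im) ^ 2) * L w u (hat q)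
        + ((w.re - u.re) ^ 2 + (w.im - u.im) ^ 2) * L v w (hat q) + S u v w (hat q)) * hγ

include hL hS in
/-- A point of the open edge `uv` lies strictly inside the circumcircle: `S u v w q̂ < 0`. -/
theorem S_hat_neg_edge {u v w q : ℂ} (hγ : L u v (hat q) = 0) (hα : 0 < L v w (hat q))
    (hβ : 0 < L w u (hat q)) : S u v w (hat q) < 0 := by
  have hA : 0 < L v w (hat q) + L w u (hat q) := by linarith
  have huv := dist_sq_pos_of_edge hL hα hβ
  have hE : 0 < ((u.re - v.re) ^ 2 + (u.im - v.im) ^ 2) * L v w (hat q) * L w u (hat q) := by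
    positivity
  have hAS : (L v w (hat q) + L w u (hat q)) * S u v w (hat q) < 0 := by
    rw [power_hat_edge hL hS hγ]; linarith
  exact neg_of_mul_neg_right hAS hA.le

include hL hS in
/-- **Pointwise 2–3 identity on an edge** (`q̂` on the open edge `uv`): off the scaffold
`{S u v w = 0} ∪ {L w q = 0}` the typed two sides contain the same points (the typed
`prism(u,v,q)` being empty, this is a 2–2 identity). -/
theorem two_three_pointwise_edge {u v w q : ℂ} (hγ : L u v (hat q) = 0) (hα : 0 < L v w (hat q))
    (hβ : 0 < L w u (hat q)) {p : Fin 3 → ℝ} (hσ : S u v w p ≠ 0) (hw : L w q p ≠ 0) :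
    ((0 < p 2 ∧ 0 < L u v p ∧ 0 < L v w p ∧ 0 < L w u p ∧ 0 < S u v w p) ∨
      (0 < p 2 ∧ S u v w p < 0 ∧ 0 < S u v q p ∧ 0 < S v w q p ∧ 0 < S w u q p)) ↔
    ((0 < p 2 ∧ 0 < L u v p ∧ 0 < L v q p ∧ 0 < L q u p ∧ 0 < S u v q p) ∨
      (0 < p 2 ∧ 0 < L v w p ∧ 0 < L w q p ∧ 0 < L q v p ∧ 0 < S v w q p) ∨
      (0 < p 2 ∧ 0 < L w u p ∧ 0 < L u q p ∧ 0 < L q w p ∧ 0 < S w u q p)) := by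
  by_cases ht : 0 < p 2
  · simp only [ht, true_and]
    have hA : 0 < L u v (hat q) + L v w (hat q) + L w u (hat q) := by linarith
    have hK : 0 < -S u v w (hat q) := by linarith [S_hat_neg_edge hL hS hγ hα hβ]
    exact core_edge hα hβ hγ hK hA (spoke_uq hL u v w q p) (spoke_qu hL u v w q p)
      (spoke_vq hL u v w q p) (spoke_qv hL u v w q p) (spoke_wq hL u v w q p)
      (spoke_qw hL u v w q p) (sphere_uvq hL hS u v w q p) (sphere_vwq hL hS u v w q p)
      (sphere_wuq hL hS u v w q p) hσ hw
  · simp only [ht, false_and, or_self]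

include hL hS in
/-- The edge scaffold `{S u v w = 0} ∪ {L w q = 0}` is null. -/
theorem volume_scaffold_edge_eq_zero {u v w q : ℂ} (hγ : L u v (hat q) = 0)
    (hα : 0 < L v w (hat q)) (hβ : 0 < L w u (hat q)) :
    volume {p : Fin 3 → ℝ | S u v w p = 0 ∨ L w q p = 0} = 0 := by
  have hSq : S u v w (hat q) ≠ 0 := (S_hat_neg_edge hL hS hγ hα hβ).ne
  have hw : L w q (hat v) ≠ 0 := by rw [L_wq_hat_v hL]; exact hα.ne'
  simp only [setOf_or]
  exact measure_union_null (volume_setOf_S_eq_zero hS hSq) (volume_setOf_L_eq_zero hL hw)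

include hL hS in
/-- **The 2–3 relation with `q̂` ON the open edge `uv` is still a KZ relation** (any common
integrand; the typed `prism(u,v,q)` is empty, `r₁` is a null representation). -/
theorem pachnerTwoThree_edge_general {u v w q : ℂ} (hγ : L u v (hat q) = 0)
    (hα : 0 < L v w (hat q)) (hβ : 0 < L w u (hat q)) (f : (Fin 3 → ℝ) → ℝ)
    (rP rI r₁ r₂ r₃ : KZ.IntegralRep 3)
    (hP : rP.domain = {p | 0 < p 2 ∧ 0 < L u v p ∧ 0 < L v w p ∧ 0 < L w u p ∧ 0 < S u v w p})
    (hI : rI.domain = {p | 0 < p 2 ∧ S u v w p < 0 ∧ 0 < S u v q p ∧ 0 < S v w q p ∧ 0 < S w u q p})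
    (hr₁ : r₁.domain = {p | 0 < p 2 ∧ 0 < L u v p ∧ 0 < L v q p ∧ 0 < L q u p ∧ 0 < S u v q p})
    (hr₂ : r₂.domain = {p | 0 < p 2 ∧ 0 < L v w p ∧ 0 < L w q p ∧ 0 < L q v p ∧ 0 < S v w q p})
    (hr₃ : r₃.domain = {p | 0 < p 2 ∧ 0 < L w u p ∧ 0 < L u q p ∧ 0 < L q w p ∧ 0 < S w u q p})
    (fP : EqOn rP.integrand f rP.domain) (fI : EqOn rI.integrand f rI.domain)
    (f₁ : EqOn r₁.integrand f r₁.domain) (f₂ : EqOn r₂.integrand f r₂.domain)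
    (f₃ : EqOn r₃.integrand f r₃.domain) :
    KZ.of rP + KZ.of rI - KZ.of r₁ - KZ.of r₂ - KZ.of r₃ ∈ KZ.relations := by
  set Z : Set (Fin 3 → ℝ) := {p | S u v w p = 0 ∨ L w q p = 0} with hZ_def
  have hZ : volume Z = 0 := volume_scaffold_edge_eq_zero hL hS hγ hα hβ
  have hpt : ∀ p, p ∉ Z → ((p ∈ rP.domain ∨ p ∈ rI.domain) ↔
      (p ∈ r₁.domain ∨ p ∈ r₂.domain ∨ p ∈ r₃.domain)) := by
    intro p hp
    simp only [hZ_def, mem_setOf_eq, not_or] at hp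
    rw [hP, hI, hr₁, hr₂, hr₃]
    simp only [mem_setOf_eq]
    exact two_three_pointwise_edge hL hS hγ hα hβ hp.1 hp.2
  have hdisj : Disjoint rP.domain rI.domain := by
    rw [Set.disjoint_left]
    intro p hp hp'
    rw [hP] at hp
    rw [hI] at hp'
    exact absurd hp.2.2.2.2 (not_lt.mpr hp'.2.1.le)
  set r := rP.glue rI hdisj with hr_def
  have hglue : KZ.of r - KZ.of rP - KZ.of rI ∈ KZ.relations :=
    KZ.domainAddRel_subset_relations (KZ.IntegralRep.of_glue_sub_sub_mem_domainAddRel rP rI hdisj)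
  have hrint : EqOn r.integrand f r.domain := by
    intro p hp
    rcases hp with hp | hp
    · rw [KZ.IntegralRep.eqOn_integrand_glue_left rP rI hdisj hp]; exact fP hp
    · rw [KZ.IntegralRep.eqOn_integrand_glue_right rP rI hdisj hp]; exact fI hp
  have sub₁ : r₁.domain \ r.domain ⊆ Z := by
    intro p hp
    by_contra hz
    exact hp.2 ((hpt p hz).mpr (Or.inl hp.1))
  have sub₂ : r₂.domain \ r.domain ⊆ Z := by
    intro p hp
    by_contra hz
    exact hp.2 ((hpt p hz).mpr (Or.inr (Or.inl hp.1)))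
  have sub₃ : r₃.domain \ r.domain ⊆ Z := by
    intro p hp
    by_contra hz
    exact hp.2 ((hpt p hz).mpr (Or.inr (Or.inr hp.1)))
  have subc : r.domain \ (r₁.domain ∪ r₂.domain ∪ r₃.domain) ⊆ Z := by
    intro p hp
    by_contra hz
    have := (hpt p hz).mp hp.1
    rcases this with h | h | h
    · exact hp.2 (Or.inl (Or.inl h))
    · exact hp.2 (Or.inl (Or.inr h))
    · exact hp.2 (Or.inr h)
  have e12 : r₁.domain ∩ r₂.domain = ∅ := by
    ext p
    simp only [mem_inter_iff, mem_empty_iff_false, iff_false, not_and]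
    intro hp hp'
    rw [hr₁] at hp
    rw [hr₂] at hp'
    have := L_anti hL v q p
    linarith [hp.2.2.1, hp'.2.2.2.1]
  have e13 : r₁.domain ∩ r₃.domain = ∅ := by
    ext p
    simp only [mem_inter_iff, mem_empty_iff_false, iff_false, not_and]
    intro hp hp'
    rw [hr₁] at hp
    rw [hr₃] at hp'
    have := L_anti hL u q p
    linarith [hp.2.2.2.1, hp'.2.2.1]
  have e23 : r₂.domain ∩ r₃.domain = ∅ := by
    ext p
    simp only [mem_inter_iff, mem_empty_iff_false, iff_false, not_and]
    intro hp hp'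
    rw [hr₂] at hp
    rw [hr₃] at hp'
    have := L_anti hL w q p
    linarith [hp.2.2.1, hp'.2.2.2.1]
  have hsplit : KZ.of r - KZ.of r₁ - KZ.of r₂ - KZ.of r₃ ∈ KZ.relations :=
    of_sub_three_mem_relations r r₁ r₂ r₃ (measure_mono_null sub₁ hZ)
      (measure_mono_null sub₂ hZ) (measure_mono_null sub₃ hZ)
      (fun p hp => by rw [f₁ hp.1, hrint hp.2]) (fun p hp => by rw [f₂ hp.1, hrint hp.2])
      (fun p hp => by rw [f₃ hp.1, hrint hp.2]) (measure_mono_null subc hZ)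
      (by rw [e12, measure_empty]) (by rw [e13, measure_empty]) (by rw [e23, measure_empty])
  have e : KZ.of rP + KZ.of rI - KZ.of r₁ - KZ.of r₂ - KZ.of r₃ =
      (KZ.of r - KZ.of r₁ - KZ.of r₂ - KZ.of r₃) - (KZ.of r - KZ.of rP - KZ.of rI) := by abel
  rw [e]
  exact KZ.relations.sub_mem hsplit hglue

include hL in
/-- If `q̂` lies on the lines `uv` and `wu` of a non-degenerate triangle then `q = u`. -/
theorem eq_vertex {u v w q : ℂ} (hγ : L u v (hat q) = 0) (hβ : L w u (hat q) = 0)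
    (hA : 0 < L u v (hat w)) : q = u := by
  have kγ := hγ
  have kβ := hβ
  have kA := hA
  simp only [hL, hat_zero, hat_one] at kγ kβ kA
  have hre : ((v.re - u.re) * (w.im - u.im) - (v.im - u.im) * (w.re - u.re)) * (q.re - u.re) = 0 := by
    linear_combination (w.re - u.re) * kγ + (v.re - u.re) * kβ
  have him : ((v.re - u.re) * (w.im - u.im) - (v.im - u.im) * (w.re - u.re)) * (q.im - u.im) = 0 := by
    linear_combination (w.im - u.im) * kγ + (v.im - u.im) * kβ
  have h1 : q.re - u.re = 0 := (mul_eq_zero.mp hre).resolve_left kA.ne'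
  have h2 : q.im - u.im = 0 := (mul_eq_zero.mp him).resolve_left kA.ne'
  exact Complex.ext (by linarith) (by linarith)

include hS in
/-- `S` vanishes when the first and third vertices coincide. -/
theorem S_self₁₃ (u v : ℂ) (p : Fin 3 → ℝ) : S u v u p = 0 := by
  simp only [hS]; ring

include hL hS in
/-- **The 2–3 relation with `q = u` (a vertex) is a KZ relation**: the typed inner region and
the prisms `prism(u,v,q)`, `prism(w,u,q)` are EMPTY, and `prism(v,w,q) = prism(u,v,w)`. -/
theorem pachnerTwoThree_vertex_general {u v w q : ℂ} (hγ : L u v (hat q) = 0)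
    (hβ : L w u (hat q) = 0) (hA : 0 < L u v (hat w)) (f : (Fin 3 → ℝ) → ℝ)
    (rP rI r₁ r₂ r₃ : KZ.IntegralRep 3)
    (hP : rP.domain = {p | 0 < p 2 ∧ 0 < L u v p ∧ 0 < L v w p ∧ 0 < L w u p ∧ 0 < S u v w p})
    (hI : rI.domain = {p | 0 < p 2 ∧ S u v w p < 0 ∧ 0 < S u v q p ∧ 0 < S v w q p ∧ 0 < S w u q p})
    (hr₁ : r₁.domain = {p | 0 < p 2 ∧ 0 < L u v p ∧ 0 < L v q p ∧ 0 < L q u p ∧ 0 < S u v q p})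
    (hr₂ : r₂.domain = {p | 0 < p 2 ∧ 0 < L v w p ∧ 0 < L w q p ∧ 0 < L q v p ∧ 0 < S v w q p})
    (hr₃ : r₃.domain = {p | 0 < p 2 ∧ 0 < L w u p ∧ 0 < L u q p ∧ 0 < L q w p ∧ 0 < S w u q p})
    (fP : EqOn rP.integrand f rP.domain) (f₂ : EqOn r₂.integrand f r₂.domain) :
    KZ.of rP + KZ.of rI - KZ.of r₁ - KZ.of r₂ - KZ.of r₃ ∈ KZ.relations := by
  have hq : q = u := eq_vertex hL hγ hβ hA
  subst q
  have hI0 : rI.domain = ∅ := by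
    rw [hI]; ext p
    simp only [mem_setOf_eq, mem_empty_iff_false, iff_false, not_and, S_self₁₃ hS]
    intro _ _ h; exact absurd h (lt_irrefl 0)
  have h10 : r₁.domain = ∅ := by
    rw [hr₁]; ext p
    simp only [mem_setOf_eq, mem_empty_iff_false, iff_false, not_and, L_self hL]
    intro _ _ _ h; exact absurd h (lt_irrefl 0)
  have h30 : r₃.domain = ∅ := by
    rw [hr₃]; ext p
    simp only [mem_setOf_eq, mem_empty_iff_false, iff_false, not_and, L_self hL]
    intro _ _ h; exact absurd h (lt_irrefl 0)
  have h2P : r₂.domain = rP.domain := by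
    rw [hr₂, hP]; ext p
    simp only [mem_setOf_eq, S_cyclic hS u v w]
    constructor
    · rintro ⟨h0, h1, h2, h3, h4⟩; exact ⟨h0, h3, h1, h2, h4⟩
    · rintro ⟨h0, h1, h2, h3, h4⟩; exact ⟨h0, h2, h3, h1, h4⟩
  have eI : KZ.of rI ∈ KZ.relations :=
    KZ.of_mem_relations_of_volume_eq_zero rI (by rw [hI0, measure_empty])
  have e₁ : KZ.of r₁ ∈ KZ.relations :=
    KZ.of_mem_relations_of_volume_eq_zero r₁ (by rw [h10, measure_empty])
  have e₃ : KZ.of r₃ ∈ KZ.relations :=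
    KZ.of_mem_relations_of_volume_eq_zero r₃ (by rw [h30, measure_empty])
  have e₂ : KZ.of rP - KZ.of r₂ ∈ KZ.relations :=
    KZ.of_sub_of_mem_relations_of_null rP r₂ (by rw [h2P, Set.sdiff_self, measure_empty])
      (by rw [h2P, Set.sdiff_self, measure_empty])
      (fun p hp => by rw [fP hp.1, f₂ hp.2])
  have e : KZ.of rP + KZ.of rI - KZ.of r₁ - KZ.of r₂ - KZ.of r₃ =
      (KZ.of rP - KZ.of r₂) + KZ.of rI - KZ.of r₁ - KZ.of r₃ := by abel
  rw [e]
  exact KZ.relations.sub_mem (KZ.relations.sub_mem (KZ.relations.add_mem e₂ eI) e₁) e₃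

/-! ### Assembly: the closed triangle -/

/-- The conclusion shape of the crux at `(u, v, w; q)` for a common integrand `f`
(verbatim typed domains). -/
def Concl (L : ℂ → ℂ → (Fin 3 → ℝ) → ℝ) (S : ℂ → ℂ → ℂ → (Fin 3 → ℝ) → ℝ)
    (f : (Fin 3 → ℝ) → ℝ) (u v w q : ℂ) : Prop :=
  ∀ (rP rI r₁ r₂ r₃ : KZ.IntegralRep 3),
    rP.domain = {p | 0 < p 2 ∧ 0 < L u v p ∧ 0 < L v w p ∧ 0 < L w u p ∧ 0 < S u v w p} →
    rI.domain = {p | 0 < p 2 ∧ S u v w p < 0 ∧ 0 < S u v q p ∧ 0 < S v w q p ∧ 0 < S w u q p} →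
    r₁.domain = {p | 0 < p 2 ∧ 0 < L u v p ∧ 0 < L v q p ∧ 0 < L q u p ∧ 0 < S u v q p} →
    r₂.domain = {p | 0 < p 2 ∧ 0 < L v w p ∧ 0 < L w q p ∧ 0 < L q v p ∧ 0 < S v w q p} →
    r₃.domain = {p | 0 < p 2 ∧ 0 < L w u p ∧ 0 < L u q p ∧ 0 < L q w p ∧ 0 < S w u q p} →
    EqOn rP.integrand f rP.domain → EqOn rI.integrand f rI.domain →
    EqOn r₁.integrand f r₁.domain → EqOn r₂.integrand f r₂.domain →
    EqOn r₃.integrand f r₃.domain →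
    KZ.of rP + KZ.of rI - KZ.of r₁ - KZ.of r₂ - KZ.of r₃ ∈ KZ.relations

include hS in
/-- The conclusion shape is invariant under the cyclic relabelling `(u, v, w) ↦ (v, w, u)`
(the big prism and the inner region are cyclically symmetric sets, the three small prisms are
permuted). -/
theorem concl_of_cyclic {f : (Fin 3 → ℝ) → ℝ} {u v w q : ℂ} (h : Concl L S f v w u q) :
    Concl L S f u v w q := by
  intro rP rI r₁ r₂ r₃ hP hI hr₁ hr₂ hr₃ fP fI f₁ f₂ f₃
  have hP' : rP.domain =
      {p | 0 < p 2 ∧ 0 < L v w p ∧ 0 < L w u p ∧ 0 < L u v p ∧ 0 < S v w u p} := by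
    rw [hP]; ext p
    simp only [mem_setOf_eq, S_cyclic hS u v w]
    constructor
    · rintro ⟨h0, h1, h2, h3, h4⟩; exact ⟨h0, h2, h3, h1, h4⟩
    · rintro ⟨h0, h1, h2, h3, h4⟩; exact ⟨h0, h3, h1, h2, h4⟩
  have hI' : rI.domain =
      {p | 0 < p 2 ∧ S v w u p < 0 ∧ 0 < S v w q p ∧ 0 < S w u q p ∧ 0 < S u v q p} := by
    rw [hI]; ext p
    simp only [mem_setOf_eq, S_cyclic hS u v w]
    constructor
    · rintro ⟨h0, h1, h2, h3, h4⟩; exact ⟨h0, h1, h3, h4, h2⟩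
    · rintro ⟨h0, h1, h2, h3, h4⟩; exact ⟨h0, h1, h4, h2, h3⟩
  have := h rP rI r₂ r₃ r₁ hP' hI' hr₂ hr₃ hr₁ fP fI f₂ f₃ f₁
  have e : KZ.of rP + KZ.of rI - KZ.of r₁ - KZ.of r₂ - KZ.of r₃ =
      KZ.of rP + KZ.of rI - KZ.of r₂ - KZ.of r₃ - KZ.of r₁ := by abel
  rw [e]; exact this

include hL hS in
/-- **The 2–3 relation on the CLOSED triangle (general integrand).**  For a non-degenerate
counter-clockwise triangle (`0 < L u v ŵ`) and `q̂` in the closed triangle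
(`0 ≤ L u v q̂, L v w q̂, L w u q̂`) the typed combination is a KZ relation: interior (§4),
open edges (`pachnerTwoThree_edge_general` and its cyclic relabellings), vertices
(`pachnerTwoThree_vertex_general`). -/
theorem pachnerTwoThree_closed_general {u v w q : ℂ} (h1 : 0 ≤ L u v (hat q))
    (h2 : 0 ≤ L v w (hat q)) (h3 : 0 ≤ L w u (hat q)) (hA : 0 < L u v (hat w))
    (f : (Fin 3 → ℝ) → ℝ) : Concl L S f u v w q := by
  have hsum := L_sum_hat hL u v w q
  have hA₂ : 0 < L v w (hat u) := by
    have e : L v w (hat u) = L u v (hat w) := by simp only [hL, hat_zero, hat_one]; ring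
    rw [e]; exact hA
  have hA₃ : 0 < L w u (hat v) := by
    have e : L w u (hat v) = L u v (hat w) := by simp only [hL, hat_zero, hat_one]; ring
    rw [e]; exact hA
  have vtx : ∀ {a b c : ℂ}, L a b (hat q) = 0 → L c a (hat q) = 0 → 0 < L a b (hat c) →
      Concl L S f a b c q :=
    fun hγ hβ hA' rP rI r₁ r₂ r₃ dP dI d₁ d₂ d₃ fP _ _ f₂ _ =>
      pachnerTwoThree_vertex_general hL hS hγ hβ hA' f rP rI r₁ r₂ r₃ dP dI d₁ d₂ d₃ fP f₂
  rcases h1.lt_or_eq with h1 | h1 <;> rcases h2.lt_or_eq with h2 | h2 <;>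
    rcases h3.lt_or_eq with h3 | h3
  · exact pachnerTwoThree_general hL hS h1 h2 h3 f
  · exact concl_of_cyclic hS (concl_of_cyclic hS
      (pachnerTwoThree_edge_general hL hS h3.symm h1 h2 f))
  · exact concl_of_cyclic hS (pachnerTwoThree_edge_general hL hS h2.symm h3 h1 f)
  · exact concl_of_cyclic hS (concl_of_cyclic hS (vtx h3.symm h2.symm hA₃))
  · exact pachnerTwoThree_edge_general hL hS h1.symm h2 h3 f
  · exact vtx h1.symm h3.symm hA
  · exact concl_of_cyclic hS (vtx h2.symm h1.symm hA₂)
  · exfalso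
    rw [← h1, ← h2, ← h3] at hsum
    linarith

/-- THE CRUX WITH ITS THREE INTERIOR HYPOTHESES WEAKENED TO `0 ≤ …` (closed triangle), the
non-degeneracy `0 < L u v ŵ` of the counter-clockwise triangle (automatic under the strict
hypotheses of the crux, `L_sum_hat`) made explicit; everything else verbatim. -/
def PachnerTwoThreeClosed : Prop :=
  ∀ (L : ℂ → ℂ → (Fin 3 → ℝ) → ℝ), (∀ u v p, L u v p = (v.re - u.re) * (p 1 - u.im) - (v.im - u.im) * (p 0 - u.re)) →
  ∀ (S : ℂ → ℂ → ℂ → (Fin 3 → ℝ) → ℝ), (∀ u v w p, S u v w p = (p 0 ^ 2 + p 1 ^ 2 + p 2 ^ 2) * (u.re * (v.im - w.im) - u.im * (v.re - w.re) + (v.re * w.im - v.im * w.re)) - p 0 * (Complex.normSq u * (v.im - w.im) - u.im * (Complex.normSq v - Complex.normSq w) + (Complex.normSq v * w.im - v.im * Complex.normSq w)) + p 1 * (Complex.normSq u * (v.re - w.re) - u.re * (Complex.normSq v - Complex.normSq w) + (Complex.normSq v * w.re - v.re * Complex.normSq w)) - (Complex.normSq u * (v.re * w.im - v.im * w.re)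 - u.re * (Complex.normSq v * w.im - v.im * Complex.normSq w) + u.im * (Complex.normSq v * w.re - v.re * Complex.normSq w))) →
  ∀ (P : ℂ → ℂ → ℂ → Set (Fin 3 → ℝ)),
    (∀ u v w, P u v w = {p | 0 < p 2 ∧ 0 < L u v p ∧ 0 < L v w p ∧ 0 < L w u p ∧ 0 < S u v w p}) →
  ∀ (u v w q : ℂ), IsAlgebraic ℚ u → IsAlgebraic ℚ v → IsAlgebraic ℚ w → IsAlgebraic ℚ q →
    0 < L u v ![w.re, w.im, 0] →
    0 ≤ L u v ![q.re, q.im, 0] → 0 ≤ L v w ![q.re, q.im, 0] → 0 ≤ L w u ![q.re, q.im, 0] →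
  ∀ (rP rI r₁ r₂ r₃ : KZ.IntegralRep 3),
    rP.domain = P u v w →
    rI.domain = {p | 0 < p 2 ∧ S u v w p < 0 ∧ 0 < S u v q p ∧ 0 < S v w q p ∧ 0 < S w u q p} →
    r₁.domain = P u v q → r₂.domain = P v w q → r₃.domain = P w u q →
    EqOn rP.integrand (fun p => 1 / p 2 ^ 3) rP.domain →
    EqOn rI.integrand (fun p => 1 / p 2 ^ 3) rI.domain →
    EqOn r₁.integrand (fun p => 1 / p 2 ^ 3) r₁.domain →
    EqOn r₂.integrand (fun p => 1 / p 2 ^ 3) r₂.domain →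
    EqOn r₃.integrand (fun p => 1 / p 2 ^ 3) r₃.domain →
    KZ.of rP + KZ.of rI - KZ.of r₁ - KZ.of r₂ - KZ.of r₃ ∈ KZ.relations

/-- **Tightness on the inside: the closed-triangle weakening of the crux is TRUE.**  Together
with §5c (`pachnerTwoThree_false_without_interior₁/₂/₃`: `q̂` strictly across an edge makes the
typed combination a non-relation at `C₂`) this locates the boundary of validity of the typed
statement exactly at the edges: the closed triangle is inside the truth region, and immediately
across an edge (inside the circumcircle) there are refuting configurations. -/
theorem pachnerTwoThreeClosed_holds : PachnerTwoThreeClosed := by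
  intro L hL S hS P hP u v w q _ _ _ _ hA h1 h2 h3 rP rI r₁ r₂ r₃ dP dI d₁ d₂ d₃ fP fI f₁ f₂ f₃
  rw [hP] at dP d₁ d₂ d₃
  exact pachnerTwoThree_closed_general hL hS h1 h2 h3 hA _ rP rI r₁ r₂ r₃ dP dI d₁ d₂ d₃
    fP fI f₁ f₂ f₃

/-- The closed version implies the crux (its hypotheses are weaker: under the strict interior
hypotheses the non-degeneracy `0 < L u v ŵ = α + β + γ` is automatic). -/
theorem pachnerTwoThree_of_closed (h : PachnerTwoThreeClosed) :
    Summit.KontsevichZagierPeriods.KontsevichZagierPeriods.Theses.HyperbolicBloch.PachnerTwoThree := by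
  intro L hL S hS P hP u v w q hu hv hw hq h1 h2 h3
  have hA : 0 < L u v ![w.re, w.im, 0] := by
    have := L_sum_hat hL u v w q
    simp only [hat] at this
    linarith
  exact h L hL S hS P hP u v w q hu hv hw hq hA h1.le h2.le h3.le

end Edge

/-! ## §8 (g3) Audit of the active line's hardest stub `stub_indicatorCriterion`

The registered skeleton `Lines/indicator-criterion.lean` (sha fcf5d5fe) has one open stub of
substance, the signed simple-valuation lemma `IndicatorCriterion` (verbatim below).  ADVERSARY'S
VERDICT: TRUE — no kill; it is provable from the tree as it stands.  Why it resists (= proof route,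
every lemma named exists): the atoms `A_ε = ⋂ᵢ σᵢ^{±}` (`ε : Fin k → Bool`, not all `false`) of
the Boolean algebra of the domains are `ℚ`-semialgebraic (`IsSemialgebraic.inter`, `.diff`); the
atom representation is `(r i).restrict A_ε …` for any `i` with `εᵢ = true` — NO semialgebraicity
of `f` is needed, and two choices of `i` differ by `KZ.of_sub_of_mem_relations_of_eqOn`;
`[r i] − ∑_{ε : εᵢ} [atom_ε] ∈ relations` by `KZ.of_sub_sum_of_mem_relations` (exact finite
partition, overlaps empty); regrouping, `∑ᵢ cᵢ [rᵢ] ≡ ∑_ε (∑_{i : εᵢ} cᵢ) [atom_ε]`; an atom of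
positive volume contains a point where the a.e. hypothesis holds, and there
`∑ᵢ cᵢ 1_{σᵢ} = ∑_{i : εᵢ} cᵢ`, so the coefficient vanishes; a null atom is itself a relation
(`KZ.of_mem_relations_of_volume_eq_zero`).  `n = 0` is harmless (one-point space of volume 1);
`k = 0` is `0 ∈ relations`.  Below: the one-term case as a model (`indicatorCriterion_single`),
the load-bearing common-integrand hypothesis (`indicatorCriterion_false_without_commonIntegrand`,
witness `[RP] − [RP.neg]` at `C₂`), and SHARPNESS: inside the additivity sub-calculus
(moves (1a)+(1b)) the criterion is an equivalence — every window integral of the weighted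
indicator vanishes (`indicatorCriterion_converse_add`, via the tree's `KZ.restrictedEval`). -/
section IndicatorCriterionAudit

/-- The registered stub `stub_indicatorCriterion`, verbatim (documentation of what was attacked). -/
def IndicatorCriterion : Prop :=
  ∀ (n k : ℕ) (f : (Fin n → ℝ) → ℝ) (r : Fin k → Literature.NumberTheory.Transcendental.KZ.IntegralRep n) (c : Fin k → ℤ), (∀ i, Set.EqOn (r i).integrand f (r i).domain) → (∀ᵐ x ∂(MeasureTheory.volume : MeasureTheory.Measure (Fin n → ℝ)), ∑ i, (c i : ℝ) * (r i).domain.indicator (fun _ => (1 : ℝ)) x = 0) → ∑ i, c i • Literature.NumberTheory.Transcendental.KZ.of (r i) ∈ Literature.NumberTheory.Transcendental.KZ.relations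

/-- **Model: the one-term case of the criterion** (`k = 1` up to bookkeeping): if `c · 1_σ = 0`
a.e. then `c • [r] ∈ relations` (`c = 0`, or `σ` is null and `[r]` is a relation). -/
theorem indicatorCriterion_single {n : ℕ} (r : KZ.IntegralRep n) (c : ℤ)
    (h : ∀ᵐ x ∂(volume : Measure (Fin n → ℝ)),
      (c : ℝ) * r.domain.indicator (fun _ => (1 : ℝ)) x = 0) :
    c • KZ.of r ∈ KZ.relations := by
  by_cases hc : c = 0
  · rw [hc, zero_smul]; exact KZ.relations.zero_mem
  · have hae : ∀ᵐ x ∂(volume : Measure (Fin n → ℝ)), x ∉ r.domain := by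
      filter_upwards [h] with x hx
      intro hxr
      rw [indicator_of_mem hxr, mul_one] at hx
      exact hc (by exact_mod_cast hx)
    have hvol : volume r.domain = 0 := by simpa using ae_iff.mp hae
    exact KZ.relations.zsmul_mem (KZ.of_mem_relations_of_volume_eq_zero r hvol) c

/-- The stub with its common-integrand hypothesis `∀ i, EqOn (r i).integrand f (r i).domain`
DELETED (everything else verbatim). -/
def IndicatorCriterionWithoutCommonIntegrand : Prop :=
  ∀ (n k : ℕ) (r : Fin k → KZ.IntegralRep n) (c : Fin k → ℤ),
    (∀ᵐ x ∂(volume : Measure (Fin n → ℝ)),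
        ∑ i, (c i : ℝ) * (r i).domain.indicator (fun _ => (1 : ℝ)) x = 0) →
    ∑ i, c i • KZ.of (r i) ∈ KZ.relations

/-- **The common-integrand hypothesis of the stub is load-bearing**: `[RP] − [RP.neg]` (the prism
of `C₂` with integrands `t⁻³` and `−t⁻³`) has weighted indicator `1_σ − 1_σ = 0` everywhere but
value `2 · vol > 0`, so it is not a relation (soundness). -/
theorem indicatorCriterion_false_without_commonIntegrand :
    ¬ IndicatorCriterionWithoutCommonIntegrand := by
  intro h
  have hmem := h 3 2 ![RP, RP.neg] ![1, -1] (Filter.Eventually.of_forall fun x => by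
    simp [Fin.sum_univ_two])
  have h0 := KZ.relations_le_ker_eval_holds hmem
  rw [AddMonoidHom.mem_ker] at h0
  simp [Fin.sum_univ_two] at h0
  have hpos : 0 < RP.value := prismRep_value_pos uC vC wC algU algV algW C₂_ccw
  linarith

/-- **Sharpness of the criterion in the additivity sub-calculus.**  If a same-integrand
combination lies in the subgroup generated by the two additivity moves (1a) + (1b) alone, then the
integral of `f` against the weighted indicator vanishes over EVERY measurable window `A` (hence the
weighted indicator is `0` a.e. wherever `f ≠ 0`): the converse of the stub inside the sub-calculus
where its proof lives (the tree's `KZ.restrictedEval` invariant). -/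
theorem indicatorCriterion_converse_add {n k : ℕ} (f : (Fin n → ℝ) → ℝ)
    (r : Fin k → KZ.IntegralRep n) (c : Fin k → ℤ)
    (hf : ∀ i, EqOn (r i).integrand f (r i).domain)
    (hmem : ∑ i, c i • KZ.of (r i) ∈ AddSubgroup.closure (KZ.domainAddRel ∪ KZ.integrandAddRel))
    (A : Set (Fin n → ℝ)) (hA : MeasurableSet A) :
    ∑ i, (c i : ℝ) * ∫ x in (r i).domain ∩ A, f x = 0 := by
  classical
  let W : (m : ℕ) → Set (Fin m → ℝ) := fun m => if h : n = m then h ▸ A else univ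
  have hW : ∀ m, MeasurableSet (W m) := by
    intro m
    by_cases h : n = m
    · subst h; simpa [W] using hA
    · simp [W, h]
  have hWn : W n = A := by simp [W]
  have hker := KZ.closure_add_le_ker_restrictedEval W hW hmem
  rw [AddMonoidHom.mem_ker, map_sum] at hker
  simp only [map_zsmul, KZ.restrictedEval_of, zsmul_eq_mul] at hker
  rw [hWn] at hker
  have e : ∀ i, ∫ x in (r i).domain ∩ A, (r i).integrand x = ∫ x in (r i).domain ∩ A, f x :=
    fun i => setIntegral_congr_fun
      ((KZ.IntegralRep.measurableSet_domain_holds (r i)).inter hA) ((hf i).mono inter_subset_left)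
  simpa only [e] using hker

end IndicatorCriterionAudit

end Summit.KontsevichZagierPeriods.Cruxes.PachnerTwoThree.Disproof
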